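import Mathlib
import Literature.NumberTheory.Automorphic.InvariantLaplacian
import Literature.NumberTheory.Automorphic.InvariantIntegralOperators
import Literature.NumberTheory.Automorphic.InvariantOperatorRegularity
import Literature.NumberTheory.Automorphic.CuspidalSubspace

/-!
# Green's identity on `ℍ` against weights and the invariant Dirichlet form
(Iwaniec, *Spectral Methods of Automorphic Forms*, GSM 53, §4.1: (4.1)–(4.3), Lemma 4.1 and the
remark after it; §1.6 (1.19); proof of Theorem 11.4, §11.3; PDF pp. 16, 47–48, 121–122)

Layer 23a of the `provefact` decomposition of `Literature.NumberTheory.Automorphic.sl2BallCount_asymp`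
(`HyperbolicLatticeCount.lean`): the calculus behind **Lemma 4.1** ("`⟨-Δf, g⟩ = ∫_F ∇f ∇̄g dx dy`
… so `-Δ` is non-negative", with the observation "the quantity `y² ∇f ∇̄g` is `G`-invariant") and
behind Roelcke's proof of **Theorem 11.4** (`λ₁ ≥ 3π²/2` for `SL₂(ℤ)`, the input of Corollary 11.5:
real spectral parameters, required by `ModularSpectralDatum`). Iwaniec integrates by parts over a
fundamental polygon `F`, the boundary terms cancelling along equivalent sides; to avoid Stokes'
formula on curvilinear polygons we integrate by parts on `ℍ` and on the strip against *weights*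
(compactly supported, resp. depending on `Im z` only) — no boundary terms arise at all. The passage
to `F` (unfolding against automorphic partitions of unity) is the next layer. Everything here is
proved; nothing is vendored.

1. **The gradient pairing** `∇f·∇ḡ = f_x ḡ_x + f_y ḡ_y` (`gradPair`) and the energy density
   `|∇f|²` (`gradNormSq`) of functions on `ℍ` (real Fréchet derivatives of the `ℂ`-extension
   `f ∘ ofComplex`, `hypFDeriv`), and their **conformal invariance** under `GL₂⁺(ℝ)`:
   `(Im z)² ∇(f₁∘g)·∇(f₂∘g)‾(z) = (Im gz)² (∇f₁·∇f̄₂)(gz)` (`gradPair_comp_smul`,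
   `gradNormSq_comp_smul`; chain rule with the holomorphic extension of the action,
   `UpperHalfPlane.deriv_smul`, and the frame-independence of `Σ_e A(e) C̄(e)`, `pair_conformal`).
   In particular `|y∇u|²` of an automorphic `u` is an automorphic function.
2. **Integration by parts on the open half-plane** (as a subset of `ℂ`): the integral of a partial
   derivative of a compactly supported `C¹` function vanishes (`integral_fderiv_eq_zero`: Fubini and
   the fundamental theorem of calculus on lines), whence `∫ (∂ₑ∂ₑF) G = -∫ ∂ₑF ∂ₑG` for
   `F ∈ C²(U)`, `G ∈ C¹(U)` compactly supported in the open set `U` (`integral_fderiv_fderiv_mul_eq_neg`).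
3. **Green's first identity on `ℍ` against a compactly supported weight** (`green_weight`): for
   `u ∈ C²(ℍ)` and a real `C¹` weight `θ` of compact support,
   `∫_ℍ (-Δu) ū θ dμ = ∫_ℍ |y∇u|² θ dμ + ∫_ℍ y² ū (∇u·∇θ) dμ` (`Δ = y²(∂ₓ² + ∂ᵧ²)`,
   `dμ = y⁻² dx dy`; the weight is extended by zero to `ℂ`, `extendZero`).
4. **Periodisation.** The bump `χ(x) = ST(x+1) - ST(x)` (`unitBump`, `ST` = `Real.smoothTransition`)
   is smooth, supported in `[-1, 1]`, and its integer translates sum to `1` (telescoping: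
   `χ(x-1) + χ(x) = 1` on `[0, 1]`), with `χ'(x-1) + χ'(x) = 0`; hence `∫_ℝ p χ = ∫_0^1 p` and
   `∫_ℝ p χ' = 0` for continuous `1`-periodic `p` (`integral_mul_unitBump`, `integral_mul_deriv_unitBump`).
5. **Green's identity on the strip for `1`-periodic functions** (`strip_green`): for `u ∈ C²(ℍ)`
   with `u(z + 1) = u(z)` and `η ∈ C¹_c((0, ∞))`,
   `∫_0^∞ η(y) y⁻² ∫_0^1 (-Δu) ū dx dy = ∫_0^∞ η(y) ∫_0^1 |∇u|² dx dy + ∫_0^∞ η'(y) ∫_0^1 ū u_y dx dy`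
   — Green's formula on `[0, 1] × supp η`, the vertical sides cancelling by periodicity; this is the
   computation in the proof of Theorem 11.4 on `{0 ≤ x ≤ B, y > √3/2}`. Proof: 3 with the weight
   `θ(z) = η(Im z) χ(Re z)` (`stripWeight`), Fubini on `ℍ` (`InvariantIntegralOperators.lean`) and 4.

What is *not* here: the Dirichlet identity `λ‖u‖² = ∫_F |y∇u|² dμ` over a fundamental domain
(Lemma 4.1 proper) and Roelcke's bound — the next layer, by unfolding `green_weight`/`strip_green`
against automorphic partitions of unity — and Wirtinger's inequality on the period.

Mathlib: `fderiv_comp`, `fderiv_clm_apply`, `fderiv_fun_mul`, `ContinuousLinearEquiv.comp_fderiv`,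
`InnerProductSpace.laplacian_eq_iteratedFDeriv_complexPlane`, `iteratedFDeriv_two_apply`,
`MeasureTheory.integral_of_hasDerivAt_of_tendsto`, `integral_prod(_symm)` with
`Complex.volume_preserving_equiv_real_prod`, `HasCompactSupport.fderiv_apply`,
`notMem_tsupport_iff_eventuallyEq`, `Real.smoothTransition`, `IsLocalMin.deriv_eq_zero`,
`intervalIntegral.integral_comp_sub_right`, `UpperHalfPlane.analyticAt_smul`/`deriv_smul`/
`im_smul_eq_div_normSq`, `dist_le_dist_coe_div_sqrt`. Literature: `hypLaplacian`, `IsC2`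
(`HyperbolicLaplaceSpectrum.lean`); `ConformalLaplacian.fderiv_real_of_holomorphic`,
`comp_smul_extend_eq`, `hypLaplacian_comp_smul` (`InvariantLaplacian.lean`);
`integral_upperHalfPlane_eq_integral_complex`, `setIntegral_upperHalf_eq_iterated`,
`integrable_upperHalfPlane_iff_integrableOn_complex` (`InvariantIntegralOperators.lean`);
`continuous_hypLaplacian` (`InvariantOperatorRegularity.lean`); `translSL`, `toGL_translSL_smul`
(`CuspidalSubspace.lean`). Neither Mathlib nor Literature had Green's identities on `ℍ` or the
conformal invariance of the Dirichlet integrand (`lean search 'green.*UpperHalfPlane|Dirichlet form|gradPair|Wirtinger'`;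
`InvariantOperatorEigenfunctions.lean` has Green's identity on annuli in geodesic polar
coordinates, a different special case).

## References
* [Iwaniec2002] H. Iwaniec, *Spectral Methods of Automorphic Forms*, 2nd ed., GSM 53, AMS 2002,
  §4.1 (4.1)–(4.3) & Lemma 4.1, PDF pp. 47–48; §1.6 (1.19), PDF p. 16; §11.3, proof of Thm 11.4,
  PDF pp. 121–122; (1.8), PDF p. 10.
-/

noncomputable section

open MeasureTheory Set Filter Real UpperHalfPlane
open scoped Topology MatrixGroups ComplexConjugate NNReal ENNReal

namespace Literature.NumberTheory.Automorphic

/-! ## 1. The gradient pairing and the energy density; conformal invariance -/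

section Gradient

/-- The real Fréchet derivative of (the `ℂ`-extension of) `f : ℍ → ℂ` at `z`. [folklore] -/
def hypFDeriv (f : ℍ → ℂ) (z : ℍ) : ℂ →L[ℝ] ℂ := fderiv ℝ (f ∘ ofComplex : ℂ → ℂ) (z : ℂ)

/-- The Euclidean gradient pairing `∇f · ∇ḡ = f_x ḡ_x + f_y ḡ_y` of `f, g : ℍ → ℂ` at `z`
(the integrand `∇f ∇̄g` of Lemma 4.1). [cite: Iwaniec2002, Lemma 4.1 & (4.1), PDF pp. 47–48] -/
def gradPair (f g : ℍ → ℂ) (z : ℍ) : ℂ :=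
  hypFDeriv f z 1 * conj (hypFDeriv g z 1) + hypFDeriv f z Complex.I * conj (hypFDeriv g z Complex.I)

/-- The Euclidean energy density `|∇f|² = |f_x|² + |f_y|²` of `f : ℍ → ℂ` at `z`; the hyperbolic
(invariant) density of (4.3)/(11.17) is `|y ∇f|² = (Im z)² |∇f|²`. [cite: Iwaniec2002, (4.3), PDF p. 48] -/
def gradNormSq (f : ℍ → ℂ) (z : ℍ) : ℝ := ‖hypFDeriv f z 1‖ ^ 2 + ‖hypFDeriv f z Complex.I‖ ^ 2

/-- `|∇f|² ≥ 0`. [folklore] -/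
theorem gradNormSq_nonneg (f : ℍ → ℂ) (z : ℍ) : 0 ≤ gradNormSq f z := by
  unfold gradNormSq; positivity

/-- `|∇f|² = ∇f · ∇f̄`. [folklore] -/
theorem gradPair_self (f : ℍ → ℂ) (z : ℍ) : gradPair f f z = (gradNormSq f z : ℂ) := by
  unfold gradPair gradNormSq
  rw [Complex.mul_conj, Complex.mul_conj, Complex.normSq_eq_norm_sq, Complex.normSq_eq_norm_sq]
  push_cast
  ring

/-- `|f_x|² ≤ |∇f|²`. [folklore] -/
theorem norm_sq_hypFDeriv_one_le (f : ℍ → ℂ) (z : ℍ) : ‖hypFDeriv f z 1‖ ^ 2 ≤ gradNormSq f z := by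
  unfold gradNormSq; nlinarith [sq_nonneg ‖hypFDeriv f z Complex.I‖]

/-- The algebraic identity behind conformal invariance of the gradient pairing, in coordinates.
[folklore] -/
theorem pair_conformal_aux (A C : ℂ →L[ℝ] ℂ) (a b : ℝ) :
    A ((a : ℂ) * 1 + (b : ℂ) * Complex.I) * conj (C ((a : ℂ) * 1 + (b : ℂ) * Complex.I)) +
      A ((-b : ℝ) * (1 : ℂ) + (a : ℂ) * Complex.I) * conj (C ((-b : ℝ) * (1 : ℂ) + (a : ℂ) * Complex.I)) =
      ((a ^ 2 + b ^ 2 : ℝ) : ℂ) * (A 1 * conj (C 1) + A Complex.I * conj (C Complex.I)) := by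
  have hlin : ∀ (T : ℂ →L[ℝ] ℂ) (a b : ℝ),
      T ((a : ℂ) * 1 + (b : ℂ) * Complex.I) = (a : ℂ) * T 1 + (b : ℂ) * T Complex.I := by
    intro T a b
    rw [map_add, show (a : ℂ) * (1 : ℂ) = a • (1 : ℂ) from (Complex.real_smul).symm,
      show (b : ℂ) * Complex.I = b • Complex.I from (Complex.real_smul).symm, T.map_smul, T.map_smul,
      Complex.real_smul, Complex.real_smul]
  rw [hlin A, hlin A, hlin C, hlin C]
  simp only [map_add, map_mul, Complex.conj_ofReal]
  push_cast
  ring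

/-- The algebraic identity behind conformal invariance of the gradient pairing: for `ℝ`-linear
`A, C : ℂ → ℂ` and `c ∈ ℂ`,
`A(c) C̄(c) + A(ci) C̄(ci) = |c|² (A(1) C̄(1) + A(i) C̄(i))`. [folklore] -/
theorem pair_conformal (A C : ℂ →L[ℝ] ℂ) (c : ℂ) :
    A c * conj (C c) + A (c * Complex.I) * conj (C (c * Complex.I)) =
      (‖c‖ ^ 2 : ℂ) * (A 1 * conj (C 1) + A Complex.I * conj (C Complex.I)) := by
  obtain ⟨a, b⟩ := c
  have e1 : (⟨a, b⟩ : ℂ) = (a : ℂ) * 1 + (b : ℂ) * Complex.I := by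
    apply Complex.ext <;> simp
  have e2 : (⟨a, b⟩ : ℂ) * Complex.I = ((-b : ℝ) : ℂ) * (1 : ℂ) + (a : ℂ) * Complex.I := by
    apply Complex.ext <;> simp
  have e3 : (‖(⟨a, b⟩ : ℂ)‖ ^ 2 : ℂ) = ((a ^ 2 + b ^ 2 : ℝ) : ℂ) := by
    rw [← Complex.ofReal_pow, Complex.sq_norm, Complex.normSq_mk]; push_cast; ring
  rw [e2, e3, e1]
  exact pair_conformal_aux A C a b

variable {g : GL (Fin 2) ℝ}

/-- The derivative of the pull-back: `D(f ∘ g)(z) e = Df(gz)(e · φ_g'(z))` for `det g > 0` and `f`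
differentiable at `g z` (`φ_g` Mathlib's `ℂ`-extension of the action). [folklore] -/
theorem hypFDeriv_comp_smul (hg : 0 < g.det.val) (f : ℍ → ℂ) (z : ℍ)
    (hf : DifferentiableAt ℝ (f ∘ ofComplex : ℂ → ℂ) ((g • z : ℍ) : ℂ)) (e : ℂ) :
    hypFDeriv (fun w => f (g • w)) z e =
      hypFDeriv f (g • z) (e * deriv (fun w : ℂ => ((g • ofComplex w : ℍ) : ℂ)) (z : ℂ)) := by
  have hg' : 0 < g.val.det := hg
  set φ : ℂ → ℂ := fun w => ((g • ofComplex w : ℍ) : ℂ) with hφdef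
  have hφz : φ (z : ℂ) = ((g • z : ℍ) : ℂ) := by simp [hφdef, ofComplex_apply]
  have hφd : DifferentiableAt ℂ φ (z : ℂ) := (analyticAt_smul hg' z).differentiableAt
  unfold hypFDeriv
  rw [comp_smul_extend_eq]
  rw [← hφz] at hf
  rw [fderiv_comp _ hf (hφd.restrictScalars ℝ), ContinuousLinearMap.comp_apply,
    ConformalLaplacian.fderiv_real_of_holomorphic hφd, hφz]

/-- **Conformal invariance of the gradient pairing**: for `det g > 0` and `f₁, f₂` differentiable
at `g z`, `(Im z)² ∇(f₁∘g)·∇(f₂∘g)‾ (z) = (Im gz)² (∇f₁·∇f̄₂)(g z)` — "the quantity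
`y² ∇f ∇̄g` is `G`-invariant" (Iwaniec, after Lemma 4.1). [cite: Iwaniec2002, §4.1 (after Lemma 4.1), PDF p. 48] -/
theorem gradPair_comp_smul (hg : 0 < g.det.val) (f₁ f₂ : ℍ → ℂ) (z : ℍ)
    (hf₁ : DifferentiableAt ℝ (f₁ ∘ ofComplex : ℂ → ℂ) ((g • z : ℍ) : ℂ))
    (hf₂ : DifferentiableAt ℝ (f₂ ∘ ofComplex : ℂ → ℂ) ((g • z : ℍ) : ℂ)) :
    ((z.im : ℝ) : ℂ) ^ 2 * gradPair (fun w => f₁ (g • w)) (fun w => f₂ (g • w)) z =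
      (((g • z).im : ℝ) : ℂ) ^ 2 * gradPair f₁ f₂ (g • z) := by
  have hg' : 0 < g.val.det := hg
  set c : ℂ := deriv (fun w : ℂ => ((g • ofComplex w : ℍ) : ℂ)) (z : ℂ) with hcdef
  have hc : c = (g.val.det : ℂ) / denom g z ^ 2 := by rw [hcdef, deriv_smul hg' z]
  unfold gradPair
  simp only [hypFDeriv_comp_smul hg f₁ z hf₁, hypFDeriv_comp_smul hg f₂ z hf₂, ← hcdef, one_mul]
  rw [show Complex.I * c = c * Complex.I by ring, pair_conformal]
  -- the conformal factor: `(Im z)² |c|² = (Im gz)²`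
  have hd : denom g z ≠ 0 := denom_ne_zero g z
  have hn : Complex.normSq (denom g z) ≠ 0 := by rwa [Ne, Complex.normSq_eq_zero]
  have him : (g • z).im = g.det.val * z.im / Complex.normSq (denom g z) := by
    rw [UpperHalfPlane.im_smul_eq_div_normSq, abs_of_pos hg]
  have hcn : ‖c‖ ^ 2 = g.det.val ^ 2 / Complex.normSq (denom g z) ^ 2 := by
    rw [hc, norm_div, norm_pow, Complex.norm_real, Real.norm_of_nonneg hg'.le, div_pow,
      ← Complex.normSq_eq_norm_sq]
    rw [show (g.val.det : ℝ) = g.det.val from rfl]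
  rw [← mul_assoc]
  congr 1
  rw [← Complex.ofReal_pow, ← Complex.ofReal_pow, ← Complex.ofReal_mul, ← Complex.ofReal_pow, him, hcn]
  congr 1
  field_simp

/-- In particular `(Im z)² |∇(f ∘ g)|²(z) = (Im gz)² |∇f|²(gz)`: the hyperbolic energy density
`|y∇f|²` of an automorphic `f` is an automorphic function. [cite: Iwaniec2002, §4.1 (after Lemma 4.1), PDF p. 48] -/
theorem gradNormSq_comp_smul (hg : 0 < g.det.val) (f : ℍ → ℂ) (z : ℍ)
    (hf : DifferentiableAt ℝ (f ∘ ofComplex : ℂ → ℂ) ((g • z : ℍ) : ℂ)) :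
    z.im ^ 2 * gradNormSq (fun w => f (g • w)) z = (g • z).im ^ 2 * gradNormSq f (g • z) := by
  have h := gradPair_comp_smul hg f f z hf hf
  rw [gradPair_self, gradPair_self] at h
  exact_mod_cast h

end Gradient

/-! ## 2. Integration by parts on the open upper half-plane against compactly supported weights -/

section IBP

/-- A function which is `C^n` on an open set containing its topological support is `C^n`
everywhere (it vanishes near every other point). [folklore] -/
theorem contDiff_of_contDiffOn_of_tsupport_subset {E : Type*} [NormedAddCommGroup E] [NormedSpace ℝ E]
    {H : ℂ → E} {U : Set ℂ} (hU : IsOpen U) {n : ℕ∞} (h : ContDiffOn ℝ n H U) (hs : tsupport H ⊆ U) :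
    ContDiff ℝ n H := by
  rw [contDiff_iff_contDiffAt]
  intro z
  by_cases hz : z ∈ tsupport H
  · exact h.contDiffAt (hU.mem_nhds (hs hz))
  · have h0 : H =ᶠ[𝓝 z] 0 := notMem_tsupport_iff_eventuallyEq.mp hz
    exact (contDiffAt_const (c := (0 : E))).congr_of_eventuallyEq h0

/-- The line `x ↦ x + iy` has derivative `1`; the line `y ↦ x + iy` has derivative `i`. [folklore] -/
theorem hasDerivAt_mk_fst (x y : ℝ) : HasDerivAt (fun t : ℝ => (⟨t, y⟩ : ℂ)) 1 x := by
  have h : (fun t : ℝ => (⟨t, y⟩ : ℂ)) = fun t : ℝ => (t : ℂ) * 1 + (y : ℂ) * Complex.I := by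
    funext t; apply Complex.ext <;> simp
  rw [h]
  simpa using ((hasDerivAt_id x).ofReal_comp.mul_const (1 : ℂ)).add_const ((y : ℂ) * Complex.I)

/-- The line `y ↦ x + iy` has derivative `i`. [folklore] -/
theorem hasDerivAt_mk_snd (x y : ℝ) : HasDerivAt (fun t : ℝ => (⟨x, t⟩ : ℂ)) Complex.I y := by
  have h : (fun t : ℝ => (⟨x, t⟩ : ℂ)) = fun t : ℝ => (x : ℂ) + (t : ℂ) * Complex.I := by
    funext t; apply Complex.ext <;> simp
  rw [h]
  simpa using ((hasDerivAt_id y).ofReal_comp.mul_const Complex.I).const_add (x : ℂ)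

/-- A compactly supported function vanishes on lines far out: if `tsupport H ⊆ B(0, R)` then
`H ⟨x, y⟩ = 0` whenever `|x| > R` or `|y| > R`. [folklore] -/
theorem eq_zero_of_abs_gt {E : Type*} [Zero E] {H : ℂ → E} {R : ℝ} (hR : tsupport H ⊆ Metric.closedBall 0 R)
    {x y : ℝ} (h : R < |x| ∨ R < |y|) : H ⟨x, y⟩ = 0 := by
  apply image_eq_zero_of_notMem_tsupport
  intro hmem
  have h1 := hR hmem
  rw [Metric.mem_closedBall, dist_zero_right] at h1
  rcases h with h | h
  · exact absurd (lt_of_lt_of_le h ((Complex.abs_re_le_norm _).trans h1)) (lt_irrefl _)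
  · exact absurd (lt_of_lt_of_le h ((Complex.abs_im_le_norm _).trans h1)) (lt_irrefl _)

/-- **The integral of a partial derivative of a compactly supported `C¹` function vanishes**
(`∂ = ∂/∂x`, direction `1`). [folklore] -/
theorem integral_fderiv_one_eq_zero {H : ℂ → ℂ} (hH : ContDiff ℝ 1 H) (hs : HasCompactSupport H) :
    ∫ z : ℂ, fderiv ℝ H z 1 = 0 := by
  obtain ⟨R, hR⟩ := hs.isCompact.isBounded.subset_closedBall 0
  have hdc : Continuous (fun z => fderiv ℝ H z (1 : ℂ)) :=
    (hH.continuous_fderiv one_ne_zero).clm_apply continuous_const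
  have hds : HasCompactSupport (fun z => fderiv ℝ H z (1 : ℂ)) :=
    hs.fderiv_apply (𝕜 := ℝ) 1
  have hint : Integrable (fun z : ℂ => fderiv ℝ H z 1) := hdc.integrable_of_hasCompactSupport hds
  -- Fubini: `∫_ℂ = ∫_y ∫_x`
  have e1 : ∫ z : ℂ, fderiv ℝ H z 1 =
      ∫ p : ℝ × ℝ, fderiv ℝ H (Complex.measurableEquivRealProd.symm p) 1 := by
    rw [← (Complex.volume_preserving_equiv_real_prod.symm _).integral_comp
      Complex.measurableEquivRealProd.symm.measurableEmbedding]
  rw [e1]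
  have hint2 : Integrable (fun p : ℝ × ℝ => fderiv ℝ H (Complex.measurableEquivRealProd.symm p) 1)
      (volume.prod volume) := by
    rw [← Measure.volume_eq_prod]
    exact (Complex.volume_preserving_equiv_real_prod.symm _).integrable_comp_emb
      Complex.measurableEquivRealProd.symm.measurableEmbedding |>.mpr hint
  rw [Measure.volume_eq_prod, integral_prod_symm _ hint2]
  -- each line integral vanishes
  have hline : ∀ y : ℝ, ∫ x : ℝ, fderiv ℝ H (Complex.measurableEquivRealProd.symm (x, y)) 1 = 0 := by
    intro y
    simp only [Complex.measurableEquivRealProd_symm_apply]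
    have hderiv : ∀ x : ℝ, HasDerivAt (fun t : ℝ => H ⟨t, y⟩) (fderiv ℝ H ⟨x, y⟩ 1) x := by
      intro x
      have h1 := (hH.differentiable one_ne_zero ⟨x, y⟩).hasFDerivAt.comp_hasDerivAt x (hasDerivAt_mk_fst x y)
      exact h1
    have hzero : ∀ t : ℝ, R < |t| → H ⟨t, y⟩ = 0 := fun t ht => eq_zero_of_abs_gt hR (Or.inl ht)
    have htop : Tendsto (fun t : ℝ => H ⟨t, y⟩) atTop (𝓝 0) := by
      refine tendsto_const_nhds.congr' ?_
      filter_upwards [eventually_gt_atTop |R|] with t ht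
      exact (hzero t (lt_of_le_of_lt (le_abs_self R) (lt_of_lt_of_le ht (le_abs_self t)))).symm
    have hbot : Tendsto (fun t : ℝ => H ⟨t, y⟩) atBot (𝓝 0) := by
      refine tendsto_const_nhds.congr' ?_
      filter_upwards [eventually_lt_atBot (-|R|)] with t ht
      refine (hzero t ?_).symm
      have : |R| < -t := by linarith
      exact lt_of_le_of_lt (le_abs_self R) (lt_of_lt_of_le this (neg_le_abs t))
    have hline_cont : Continuous (fun t : ℝ => (⟨t, y⟩ : ℂ)) :=
      continuous_iff_continuousAt.mpr fun t => (hasDerivAt_mk_fst t y).continuousAt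
    have hint1 : Integrable (fun x : ℝ => fderiv ℝ H ⟨x, y⟩ 1) := by
      refine Continuous.integrable_of_hasCompactSupport ?_ ?_
      · exact hdc.comp hline_cont
      · refine HasCompactSupport.intro (isCompact_Icc (a := -|R| - 1) (b := |R| + 1)) fun x hx => ?_
        have hx' : R < |x| := by
          rw [mem_Icc, not_and_or, not_le, not_le] at hx
          rcases hx with hx | hx
          · have : |R| < -x := by linarith
            exact lt_of_le_of_lt (le_abs_self R) (lt_of_lt_of_le this (neg_le_abs x))
          · exact lt_of_le_of_lt (le_abs_self R) (lt_of_lt_of_le (by linarith) (le_abs_self x))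
        have hH0 : ∀ᶠ t in 𝓝 x, H ⟨t, y⟩ = 0 := by
          have hopen : IsOpen {t : ℝ | R < |t|} := isOpen_lt continuous_const continuous_abs
          filter_upwards [hopen.mem_nhds hx'] with t ht
          exact hzero t ht
        have h2 : HasDerivAt (fun t : ℝ => H ⟨t, y⟩) 0 x :=
          (hasDerivAt_const x (0 : ℂ)).congr_of_eventuallyEq hH0
        exact (hderiv x).unique h2
    have h := integral_of_hasDerivAt_of_tendsto hderiv hint1 hbot htop
    simpa using h
  simp_rw [hline, integral_zero]

/-- The same for the direction `i` (`∂/∂y`). [folklore] -/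
theorem integral_fderiv_I_eq_zero {H : ℂ → ℂ} (hH : ContDiff ℝ 1 H) (hs : HasCompactSupport H) :
    ∫ z : ℂ, fderiv ℝ H z Complex.I = 0 := by
  obtain ⟨R, hR⟩ := hs.isCompact.isBounded.subset_closedBall 0
  have hdc : Continuous (fun z => fderiv ℝ H z Complex.I) :=
    (hH.continuous_fderiv one_ne_zero).clm_apply continuous_const
  have hds : HasCompactSupport (fun z => fderiv ℝ H z Complex.I) := hs.fderiv_apply (𝕜 := ℝ) Complex.I
  have hint : Integrable (fun z : ℂ => fderiv ℝ H z Complex.I) := hdc.integrable_of_hasCompactSupport hds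
  have e1 : ∫ z : ℂ, fderiv ℝ H z Complex.I =
      ∫ p : ℝ × ℝ, fderiv ℝ H (Complex.measurableEquivRealProd.symm p) Complex.I := by
    rw [← (Complex.volume_preserving_equiv_real_prod.symm _).integral_comp
      Complex.measurableEquivRealProd.symm.measurableEmbedding]
  rw [e1]
  have hint2 : Integrable (fun p : ℝ × ℝ => fderiv ℝ H (Complex.measurableEquivRealProd.symm p) Complex.I)
      (volume.prod volume) := by
    rw [← Measure.volume_eq_prod]
    exact (Complex.volume_preserving_equiv_real_prod.symm _).integrable_comp_emb
      Complex.measurableEquivRealProd.symm.measurableEmbedding |>.mpr hint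
  rw [Measure.volume_eq_prod, integral_prod _ hint2]
  have hline : ∀ x : ℝ, ∫ y : ℝ, fderiv ℝ H (Complex.measurableEquivRealProd.symm (x, y)) Complex.I = 0 := by
    intro x
    simp only [Complex.measurableEquivRealProd_symm_apply]
    have hderiv : ∀ y : ℝ, HasDerivAt (fun t : ℝ => H ⟨x, t⟩) (fderiv ℝ H ⟨x, y⟩ Complex.I) y := by
      intro y
      exact (hH.differentiable one_ne_zero ⟨x, y⟩).hasFDerivAt.comp_hasDerivAt y (hasDerivAt_mk_snd x y)
    have hzero : ∀ t : ℝ, R < |t| → H ⟨x, t⟩ = 0 := fun t ht => eq_zero_of_abs_gt hR (Or.inr ht)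
    have htop : Tendsto (fun t : ℝ => H ⟨x, t⟩) atTop (𝓝 0) := by
      refine tendsto_const_nhds.congr' ?_
      filter_upwards [eventually_gt_atTop |R|] with t ht
      exact (hzero t (lt_of_le_of_lt (le_abs_self R) (lt_of_lt_of_le ht (le_abs_self t)))).symm
    have hbot : Tendsto (fun t : ℝ => H ⟨x, t⟩) atBot (𝓝 0) := by
      refine tendsto_const_nhds.congr' ?_
      filter_upwards [eventually_lt_atBot (-|R|)] with t ht
      refine (hzero t ?_).symm
      have : |R| < -t := by linarith
      exact lt_of_le_of_lt (le_abs_self R) (lt_of_lt_of_le this (neg_le_abs t))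
    have hline_cont : Continuous (fun t : ℝ => (⟨x, t⟩ : ℂ)) :=
      continuous_iff_continuousAt.mpr fun t => (hasDerivAt_mk_snd x t).continuousAt
    have hint1 : Integrable (fun y : ℝ => fderiv ℝ H ⟨x, y⟩ Complex.I) := by
      refine Continuous.integrable_of_hasCompactSupport ?_ ?_
      · exact hdc.comp hline_cont
      · refine HasCompactSupport.intro (isCompact_Icc (a := -|R| - 1) (b := |R| + 1)) fun y hy => ?_
        have hy' : R < |y| := by
          rw [mem_Icc, not_and_or, not_le, not_le] at hy
          rcases hy with hy | hy
          · have : |R| < -y := by linarith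
            exact lt_of_le_of_lt (le_abs_self R) (lt_of_lt_of_le this (neg_le_abs y))
          · exact lt_of_le_of_lt (le_abs_self R) (lt_of_lt_of_le (by linarith) (le_abs_self y))
        have hH0 : ∀ᶠ t in 𝓝 y, H ⟨x, t⟩ = 0 := by
          have hopen : IsOpen {t : ℝ | R < |t|} := isOpen_lt continuous_const continuous_abs
          filter_upwards [hopen.mem_nhds hy'] with t ht
          exact hzero t ht
        have h2 : HasDerivAt (fun t : ℝ => H ⟨x, t⟩) 0 y :=
          (hasDerivAt_const y (0 : ℂ)).congr_of_eventuallyEq hH0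
        exact (hderiv y).unique h2
    have h := integral_of_hasDerivAt_of_tendsto hderiv hint1 hbot htop
    simpa using h
  simp_rw [hline, integral_zero]

/-- Both coordinate directions at once. [folklore] -/
theorem integral_fderiv_eq_zero {H : ℂ → ℂ} (hH : ContDiff ℝ 1 H) (hs : HasCompactSupport H)
    {e : ℂ} (he : e = 1 ∨ e = Complex.I) : ∫ z : ℂ, fderiv ℝ H z e = 0 := by
  rcases he with rfl | rfl
  · exact integral_fderiv_one_eq_zero hH hs
  · exact integral_fderiv_I_eq_zero hH hs

/-- A product of a function continuous on an open set `U` with a continuous function whose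
topological support lies in `U` is continuous on the whole plane. [folklore] -/
theorem continuous_mul_of_tsupport_subset {U : Set ℂ} (hU : IsOpen U) {a b : ℂ → ℂ}
    (ha : ContinuousOn a U) (hb : Continuous b) (hbs : tsupport b ⊆ U) : Continuous (fun z => a z * b z) := by
  rw [continuous_iff_continuousAt]
  intro z
  by_cases hz : z ∈ tsupport b
  · exact (ha.continuousAt (hU.mem_nhds (hbs hz))).mul hb.continuousAt
  · have h0 : b =ᶠ[𝓝 z] 0 := notMem_tsupport_iff_eventuallyEq.mp hz
    have h1 : (fun z => a z * b z) =ᶠ[𝓝 z] fun _ => 0 := by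
      filter_upwards [h0] with w hw
      rw [hw, Pi.zero_apply, mul_zero]
    exact (continuousAt_const).congr_of_eventuallyEq h1

/-- `∂ₑ∂ₑF · G` is integrable for `F ∈ C²(U)` and `G` continuous compactly supported in `U`. [folklore] -/
theorem integrable_fderiv_fderiv_mul {U : Set ℂ} (hU : IsOpen U) {F G : ℂ → ℂ}
    (hF : ContDiffOn ℝ 2 F U) (hGc : Continuous G) (hGs : HasCompactSupport G) (hGU : tsupport G ⊆ U) (e : ℂ) :
    Integrable (fun z => fderiv ℝ (fun w => fderiv ℝ F w e) z e * G z) := by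
  have hF1 : ContDiffOn ℝ 1 (fun w => fderiv ℝ F w e) U :=
    (hF.fderiv_of_isOpen hU (by norm_num)).clm_apply contDiffOn_const
  refine Continuous.integrable_of_hasCompactSupport ?_ hGs.mul_left
  exact continuous_mul_of_tsupport_subset hU
    ((hF1.continuousOn_fderiv_of_isOpen hU le_rfl).clm_apply continuousOn_const) hGc hGU

/-- `∂ₑF · ∂ₑG` is integrable for `F ∈ C¹(U)` and `G ∈ C¹(U)` compactly supported in `U`. [folklore] -/
theorem integrable_fderiv_mul_fderiv {U : Set ℂ} (hU : IsOpen U) {F G : ℂ → ℂ}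
    (hF : ContDiffOn ℝ 1 F U) (hG : ContDiffOn ℝ 1 G U) (hGs : HasCompactSupport G) (hGU : tsupport G ⊆ U) (e : ℂ) :
    Integrable (fun z => fderiv ℝ F z e * fderiv ℝ G z e) := by
  have hGdc : Continuous (fun z => fderiv ℝ G z e) :=
    ((contDiff_of_contDiffOn_of_tsupport_subset hU hG hGU).continuous_fderiv one_ne_zero).clm_apply
      continuous_const
  refine Continuous.integrable_of_hasCompactSupport ?_ (hGs.fderiv_apply (𝕜 := ℝ) e).mul_left
  refine continuous_mul_of_tsupport_subset hU
    ((hF.continuousOn_fderiv_of_isOpen hU le_rfl).clm_apply continuousOn_const) hGdc ?_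
  exact (tsupport_fderiv_apply_subset ℝ e).trans hGU

/-- **Integration by parts in one direction**: for `F ∈ C²(U)`, `G ∈ C¹(U)` compactly supported
inside the open set `U ⊆ ℂ`, and `e ∈ {1, i}`,
`∫ (∂ₑ∂ₑF) G = -∫ ∂ₑF ∂ₑG`. [folklore] -/
theorem integral_fderiv_fderiv_mul_eq_neg {U : Set ℂ} (hU : IsOpen U) {F G : ℂ → ℂ}
    (hF : ContDiffOn ℝ 2 F U) (hG : ContDiffOn ℝ 1 G U) (hGs : HasCompactSupport G) (hGU : tsupport G ⊆ U)
    {e : ℂ} (he : e = 1 ∨ e = Complex.I) :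
    ∫ z : ℂ, fderiv ℝ (fun w => fderiv ℝ F w e) z e * G z = -∫ z : ℂ, fderiv ℝ F z e * fderiv ℝ G z e := by
  -- the first partial of `F` is `C¹` on `U`
  have hF1 : ContDiffOn ℝ 1 (fun w => fderiv ℝ F w e) U :=
    (hF.fderiv_of_isOpen hU (by norm_num)).clm_apply contDiffOn_const
  have hF1d : ∀ z ∈ U, DifferentiableAt ℝ (fun w => fderiv ℝ F w e) z := fun z hz =>
    (hF1.differentiableOn one_ne_zero).differentiableAt (hU.mem_nhds hz)
  have hGd : ∀ z ∈ U, DifferentiableAt ℝ G z := fun z hz =>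
    (hG.differentiableOn one_ne_zero).differentiableAt (hU.mem_nhds hz)
  -- `H = ∂ₑF · G` is a compactly supported global `C¹` function
  set H : ℂ → ℂ := fun z => fderiv ℝ F z e * G z with hHdef
  have hHU : tsupport H ⊆ U := (tsupport_mul_subset_right (f := fun z => fderiv ℝ F z e) (g := G)).trans hGU
  have hHs : HasCompactSupport H := hGs.mul_left
  have hH1 : ContDiff ℝ 1 H := contDiff_of_contDiffOn_of_tsupport_subset hU (hF1.mul hG) hHU
  have h0 := integral_fderiv_eq_zero hH1 hHs he
  -- the product rule, valid everywhere
  have hprod : ∀ z, fderiv ℝ H z e =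
      fderiv ℝ (fun w => fderiv ℝ F w e) z e * G z + fderiv ℝ F z e * fderiv ℝ G z e := by
    intro z
    by_cases hz : z ∈ U
    · have h := fderiv_fun_mul (hF1d z hz) (hGd z hz)
      rw [hHdef, h]
      simp
      ring
    · have hzG : z ∉ tsupport G := fun h => hz (hGU h)
      have hzH : z ∉ tsupport H := fun h => hz (hHU h)
      have hG0 : G =ᶠ[𝓝 z] 0 := notMem_tsupport_iff_eventuallyEq.mp hzG
      have hH0 : H =ᶠ[𝓝 z] 0 := notMem_tsupport_iff_eventuallyEq.mp hzH
      rw [hH0.fderiv_eq, hG0.fderiv_eq, image_eq_zero_of_notMem_tsupport hzG]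
      simp
  have hGc : Continuous G := (contDiff_of_contDiffOn_of_tsupport_subset hU hG hGU).continuous
  have hA := integrable_fderiv_fderiv_mul hU hF hGc hGs hGU e
  have hB := integrable_fderiv_mul_fderiv hU (hF.of_le (by norm_num)) hG hGs hGU e
  simp_rw [hprod] at h0
  rw [integral_add hA hB] at h0
  linear_combination h0

end IBP

/-! ## 3. Green's first identity on `ℍ` against a compactly supported weight -/

section Green

/-- Extension by zero of a function on `ℍ` to `ℂ`. [folklore] -/
def extendZero (θ : ℍ → ℂ) (z : ℂ) : ℂ := if h : 0 < z.im then θ ⟨z, h⟩ else 0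

/-- On `ℍ` the extension is the function. [folklore] -/
@[simp] theorem extendZero_coe (θ : ℍ → ℂ) (z : ℍ) : extendZero θ z = θ z := by
  unfold extendZero; rw [dif_pos (show 0 < (z : ℂ).im from z.im_pos)]

/-- On the open upper half-plane the extension is `θ ∘ ofComplex`. [folklore] -/
theorem extendZero_of_im_pos (θ : ℍ → ℂ) {z : ℂ} (hz : 0 < z.im) : extendZero θ z = θ (ofComplex z) := by
  unfold extendZero; rw [dif_pos hz, ofComplex_apply_of_im_pos hz]

/-- Off the open upper half-plane the extension vanishes. [folklore] -/
theorem extendZero_of_not_im_pos (θ : ℍ → ℂ) {z : ℂ} (hz : ¬ 0 < z.im) : extendZero θ z = 0 := by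
  unfold extendZero; rw [dif_neg hz]

/-- The support of the extension is the image of the support. [folklore] -/
theorem support_extendZero_subset (θ : ℍ → ℂ) :
    Function.support (extendZero θ) ⊆ ((↑) : ℍ → ℂ) '' Function.support θ := by
  intro z hz
  rw [Function.mem_support] at hz
  by_cases h : 0 < z.im
  · refine ⟨⟨z, h⟩, ?_, rfl⟩
    rw [Function.mem_support]
    unfold extendZero at hz; rwa [dif_pos h] at hz
  · exact absurd (extendZero_of_not_im_pos θ h) hz

/-- The topological support of the extension of a compactly supported `θ` lies in the image of
`tsupport θ`, inside the open upper half-plane. [folklore] -/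
theorem tsupport_extendZero_subset {θ : ℍ → ℂ} (hθ : HasCompactSupport θ) :
    tsupport (extendZero θ) ⊆ ((↑) : ℍ → ℂ) '' tsupport θ := by
  have hK : IsCompact (((↑) : ℍ → ℂ) '' tsupport θ) := hθ.isCompact.image UpperHalfPlane.continuous_coe
  refine closure_minimal ?_ hK.isClosed
  exact (support_extendZero_subset θ).trans (image_mono subset_closure)

/-- … in particular inside `{Im z > 0}`. [folklore] -/
theorem tsupport_extendZero_subset_upperHalf {θ : ℍ → ℂ} (hθ : HasCompactSupport θ) :
    tsupport (extendZero θ) ⊆ {z : ℂ | 0 < z.im} := by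
  refine (tsupport_extendZero_subset hθ).trans ?_
  rintro _ ⟨w, _, rfl⟩
  exact w.im_pos

/-- The extension of a compactly supported `θ` has compact support. [folklore] -/
theorem hasCompactSupport_extendZero {θ : ℍ → ℂ} (hθ : HasCompactSupport θ) :
    HasCompactSupport (extendZero θ) :=
  (hθ.isCompact.image UpperHalfPlane.continuous_coe).of_isClosed_subset (isClosed_tsupport _)
    (tsupport_extendZero_subset hθ)

/-- The second partial `∂ₑ∂ₑF` written with `fderiv (fderiv F)`. [folklore] -/
theorem fderiv_fderiv_apply_eq {U : Set ℂ} (hU : IsOpen U) {F : ℂ → ℂ} (hF : ContDiffOn ℝ 2 F U)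
    {z : ℂ} (hz : z ∈ U) (e : ℂ) :
    fderiv ℝ (fun w => fderiv ℝ F w e) z e = fderiv ℝ (fderiv ℝ F) z e e := by
  have hd : DifferentiableAt ℝ (fderiv ℝ F) z :=
    ((hF.fderiv_of_isOpen hU (by norm_num)).differentiableOn one_ne_zero).differentiableAt (hU.mem_nhds hz)
  rw [fderiv_clm_apply hd (differentiableAt_const e)]
  simp

/-- The hyperbolic Laplacian through coordinate second partials:
`Δu(z) = (Im z)² (∂ₓ∂ₓF + ∂_y∂_yF)(z)`, `F = u ∘ ofComplex`. [cite: Iwaniec2002, (1.19), PDF p. 16] -/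
theorem hypLaplacian_eq_fderiv_fderiv {u : ℍ → ℂ} (hu : IsC2 u) (z : ℍ) :
    hypLaplacian u z = ((z.im : ℝ) : ℂ) ^ 2 *
      (fderiv ℝ (fun w => fderiv ℝ (u ∘ ofComplex) w 1) z 1 +
        fderiv ℝ (fun w => fderiv ℝ (u ∘ ofComplex) w Complex.I) z Complex.I) := by
  unfold hypLaplacian
  rw [InnerProductSpace.laplacian_eq_iteratedFDeriv_complexPlane]
  simp only [iteratedFDeriv_two_apply, Fin.isValue, Matrix.cons_val_zero, Matrix.cons_val_one]
  rw [fderiv_fderiv_apply_eq isOpen_upperHalfPlaneSet hu z.im_pos,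
    fderiv_fderiv_apply_eq isOpen_upperHalfPlaneSet hu z.im_pos]

/-- A real-valued function has real partial derivatives: if `conj ∘ Θ = Θ` then
`conj (∂ₑΘ) = ∂ₑΘ`. [folklore] -/
theorem conj_fderiv_apply_of_conj_eq {Θ : ℂ → ℂ} (h : ∀ z, conj (Θ z) = Θ z) (z e : ℂ) :
    conj (fderiv ℝ Θ z e) = fderiv ℝ Θ z e := by
  have hfun : (Complex.conjCLE ∘ Θ) = Θ := funext fun w => by simp [h w]
  have h1 := Complex.conjCLE.comp_fderiv (f := Θ) (x := z) (𝕜 := ℝ)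
  rw [hfun] at h1
  have h2 := congrArg (fun L : ℂ →L[ℝ] ℂ => L e) h1
  simp only [ContinuousLinearMap.coe_comp, ContinuousLinearEquiv.coe_coe, Function.comp_apply,
    Complex.conjCLE_apply] at h2
  exact h2.symm

/-- An integral over `ℍ` of a function of the form `(Im z)² · Φ(z)` is the plane integral of the
zero extension of `Φ` (`dμ = y⁻² dx dy`). [cite: Iwaniec2002, (1.8), PDF p. 10] -/
theorem integral_im_sq_mul_eq_integral_extendZero (Φ : ℍ → ℂ) :
    ∫ z : ℍ, ((z.im : ℝ) : ℂ) ^ 2 * Φ z = ∫ w : ℂ, extendZero Φ w := by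
  rw [integral_upperHalfPlane_eq_integral_complex]
  rw [← setIntegral_eq_integral_of_forall_compl_eq_zero (s := {z : ℂ | 0 < z.im})
    (fun w hw => extendZero_of_not_im_pos Φ hw)]
  refine setIntegral_congr_fun isOpen_upperHalfPlaneSet.measurableSet fun w hw => ?_
  have hw' : 0 < w.im := hw
  rw [extendZero_of_im_pos Φ hw', Complex.real_smul]
  rw [show ((ofComplex w : ℍ).im : ℝ) = w.im by rw [ofComplex_apply_of_im_pos hw']; rfl]
  have : (w.im : ℂ) ≠ 0 := by exact_mod_cast hw'.ne'
  push_cast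
  field_simp

/-- The values of `extendZero` are real for a real-valued `θ`. [folklore] -/
theorem conj_extendZero_ofReal (θ : ℍ → ℝ) (z : ℂ) :
    conj (extendZero (fun w => (θ w : ℂ)) z) = extendZero (fun w => (θ w : ℂ)) z := by
  unfold extendZero
  split_ifs
  · exact Complex.conj_ofReal _
  · exact map_zero _

/-- **Green's first identity on `ℍ` against a compactly supported weight** (the computation
behind Lemma 4.1, with the boundary integral replaced by a weight: no boundary occurs). For
`u ∈ C²(ℍ)` and a compactly supported `C¹` weight `θ : ℍ → ℝ`,
`∫_ℍ (-Δu) ū θ dμ = ∫_ℍ |y∇u|² θ dμ + ∫_ℍ (Im z)² ū (∇u · ∇θ) dμ`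
(`Δ = y²(∂ₓ² + ∂ᵧ²)`, `dμ = y⁻² dx dy`; in the plane this is `∫ (-Δₑu) ū θ = ∫ |∇u|² θ + ∫ ū ∇u·∇θ`,
i.e. Green's formula `∫ (Δf) ḡ = -∫ ∇f ∇̄g` with `g = u θ`).
[cite: Iwaniec2002, Lemma 4.1 & (4.1)–(4.3), PDF pp. 47–48] -/
theorem green_weight {u : ℍ → ℂ} (hu : IsC2 u) {θ : ℍ → ℝ}
    (hθ : ContDiffOn ℝ 1 (fun z : ℂ => ((θ (ofComplex z) : ℝ) : ℂ)) {z : ℂ | 0 < z.im})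
    (hθs : HasCompactSupport θ) :
    ∫ z : ℍ, -hypLaplacian u z * conj (u z) * θ z =
      (∫ z : ℍ, ((z.im ^ 2 * gradNormSq u z * θ z : ℝ) : ℂ)) +
        ∫ z : ℍ, ((z.im : ℝ) : ℂ) ^ 2 * (conj (u z) * gradPair u (fun w => (θ w : ℂ)) z) := by
  set U : Set ℂ := {z : ℂ | 0 < z.im} with hUdef
  have hUo : IsOpen U := isOpen_upperHalfPlaneSet
  set F : ℂ → ℂ := u ∘ ofComplex with hFdef
  set θc : ℍ → ℂ := fun w => (θ w : ℂ) with hθcdef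
  set Θ : ℂ → ℂ := extendZero θc with hΘdef
  have hΘU' : ∀ w : ℂ, 0 < w.im → Θ w = θc (ofComplex w) := fun w hw => extendZero_of_im_pos θc hw
  have hθcs : HasCompactSupport θc := hθs.comp_left Complex.ofReal_zero
  have hΘs : HasCompactSupport Θ := hasCompactSupport_extendZero hθcs
  have hΘU : tsupport Θ ⊆ U := tsupport_extendZero_subset_upperHalf hθcs
  have hΘ1 : ContDiffOn ℝ 1 Θ U := hθ.congr fun w hw => hΘU' w hw
  have hF2 : ContDiffOn ℝ 2 F U := hu
  have hF1 : ContDiffOn ℝ 1 F U := hF2.of_le (by norm_num)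
  set G : ℂ → ℂ := fun z => conj (F z) * Θ z with hGdef
  have hconjF : ContDiffOn ℝ 1 (fun z => conj (F z)) U :=
    Complex.conjCLE.contDiff.comp_contDiffOn hF1
  have hG1 : ContDiffOn ℝ 1 G U := hconjF.mul hΘ1
  have hGs : HasCompactSupport G := hΘs.mul_left
  have hGU : tsupport G ⊆ U := (tsupport_mul_subset_right (f := fun z => conj (F z)) (g := Θ)).trans hΘU
  have hΘreal : ∀ z, conj (Θ z) = Θ z := fun z => conj_extendZero_ofReal θ z
  -- differentiability on `U`
  have hFd : ∀ z ∈ U, DifferentiableAt ℝ F z := fun z hz =>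
    (hF1.differentiableOn one_ne_zero).differentiableAt (hUo.mem_nhds hz)
  have hΘd : ∀ z ∈ U, DifferentiableAt ℝ Θ z := fun z hz =>
    (hΘ1.differentiableOn one_ne_zero).differentiableAt (hUo.mem_nhds hz)
  have hconjFd : ∀ z ∈ U, DifferentiableAt ℝ (fun z => conj (F z)) z := fun z hz =>
    (hconjF.differentiableOn one_ne_zero).differentiableAt (hUo.mem_nhds hz)
  -- `∂ₑ (conj F) = conj ∂ₑF`
  have hconj_fderiv : ∀ z e, fderiv ℝ (fun z => conj (F z)) z e = conj (fderiv ℝ F z e) := by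
    intro z e
    have h := Complex.conjCLE.comp_fderiv (f := F) (x := z) (𝕜 := ℝ)
    have h2 := congrArg (fun L : ℂ →L[ℝ] ℂ => L e) h
    simpa [Function.comp_def] using h2
  -- `∂ₑΘ` through `θc ∘ ofComplex` on `U`
  have hΘ_fderiv : ∀ z ∈ U, ∀ e, fderiv ℝ Θ z e = hypFDeriv θc (ofComplex z) e := by
    intro z hz e
    have hz' : 0 < z.im := hz
    unfold hypFDeriv
    rw [ofComplex_apply_of_im_pos hz']
    have heq : Θ =ᶠ[𝓝 z] (θc ∘ ofComplex : ℂ → ℂ) := by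
      filter_upwards [hUo.mem_nhds hz] with w hw
      exact hΘU' w hw
    rw [heq.fderiv_eq]
  -- the product rule for `G` on `U`
  have hGderiv : ∀ z ∈ U, ∀ e, fderiv ℝ G z e = conj (fderiv ℝ F z e) * Θ z + conj (F z) * fderiv ℝ Θ z e := by
    intro z hz e
    rw [hGdef, fderiv_fun_mul (hconjFd z hz) (hΘd z hz)]
    simp [hconj_fderiv]
    ring
  -- IBP in both directions
  have I1 := integral_fderiv_fderiv_mul_eq_neg hUo hF2 hG1 hGs hGU (Or.inl rfl)
  have I2 := integral_fderiv_fderiv_mul_eq_neg hUo hF2 hG1 hGs hGU (Or.inr rfl)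
  have hGc : Continuous G := (contDiff_of_contDiffOn_of_tsupport_subset hUo hG1 hGU).continuous
  have hA1 := integrable_fderiv_fderiv_mul hUo hF2 hGc hGs hGU 1
  have hA2 := integrable_fderiv_fderiv_mul hUo hF2 hGc hGs hGU Complex.I
  have hB1 := integrable_fderiv_mul_fderiv hUo hF1 hG1 hGs hGU 1
  have hB2 := integrable_fderiv_mul_fderiv hUo hF1 hG1 hGs hGU Complex.I
  -- names for the partials at a point of `U`
  have hFU : ∀ w : ℂ, 0 < w.im → ∀ e, hypFDeriv u (ofComplex w) e = fderiv ℝ F w e := by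
    intro w hw e; unfold hypFDeriv; rw [ofComplex_apply_of_im_pos hw]
  have hΘcU : ∀ w : ℂ, 0 < w.im → ∀ e, hypFDeriv θc (ofComplex w) e = fderiv ℝ Θ w e :=
    fun w hw e => (hΘ_fderiv w hw e).symm
  have hΘr : ∀ w e, conj (fderiv ℝ Θ w e) = fderiv ℝ Θ w e := fun w e => conj_fderiv_apply_of_conj_eq hΘreal w e
  have e1 : ∀ a : ℂ, ((‖a‖ : ℝ) : ℂ) ^ 2 = a * conj a := fun a => by
    rw [Complex.mul_conj, Complex.normSq_eq_norm_sq, Complex.ofReal_pow]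
  have hcoe : ∀ w : ℂ, 0 < w.im → ((ofComplex w : ℍ) : ℂ) = w := fun w hw => by
    rw [ofComplex_apply_of_im_pos hw]
  -- LHS as a plane integral
  set Ψ : ℍ → ℂ := fun z => -(fderiv ℝ (fun w => fderiv ℝ F w 1) z 1 +
      fderiv ℝ (fun w => fderiv ℝ F w Complex.I) z Complex.I) * conj (u z) * θc z with hΨdef
  have hL : ∫ z : ℍ, -hypLaplacian u z * conj (u z) * θ z = ∫ z : ℍ, ((z.im : ℝ) : ℂ) ^ 2 * Ψ z := by
    congr 1 with z
    rw [hypLaplacian_eq_fderiv_fderiv hu z, hΨdef, hθcdef]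
    simp only
    ring
  have hLext : ∀ w : ℂ, extendZero Ψ w =
      -(fderiv ℝ (fun w => fderiv ℝ F w 1) w 1 * G w) - fderiv ℝ (fun w => fderiv ℝ F w Complex.I) w Complex.I * G w := by
    intro w
    by_cases hw : 0 < w.im
    · rw [extendZero_of_im_pos Ψ hw, hΨdef, hGdef]
      simp only
      rw [hΘU' w hw, hcoe w hw, show u (ofComplex w) = F w from rfl]
      ring
    · rw [extendZero_of_not_im_pos Ψ hw]
      have hG0 : G w = 0 := image_eq_zero_of_notMem_tsupport fun h => hw (hGU h)
      rw [hG0]; ring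
  -- the two pieces of the right-hand side, pointwise on `ℂ`
  set Ψ₁ : ℍ → ℂ := fun z => ((gradNormSq u z * θ z : ℝ) : ℂ) with hΨ₁def
  set Ψ₂ : ℍ → ℂ := fun z => conj (u z) * gradPair u θc z with hΨ₂def
  have hR1 : ∫ z : ℍ, ((z.im ^ 2 * gradNormSq u z * θ z : ℝ) : ℂ) = ∫ z : ℍ, ((z.im : ℝ) : ℂ) ^ 2 * Ψ₁ z := by
    congr 1 with z; rw [hΨ₁def]; push_cast; ring
  set P : ℂ → ℂ → ℂ := fun e w => fderiv ℝ F w e * (conj (F w) * fderiv ℝ Θ w e) with hPdef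
  set Q : ℂ → ℂ → ℂ := fun e w => fderiv ℝ F w e * (conj (fderiv ℝ F w e) * Θ w) with hQdef
  have hΨ₂ext : ∀ w, extendZero Ψ₂ w = P 1 w + P Complex.I w := by
    intro w
    by_cases hw : 0 < w.im
    · rw [extendZero_of_im_pos Ψ₂ hw, hΨ₂def, hPdef]
      simp only [gradPair]
      rw [hFU w hw, hFU w hw, hΘcU w hw, hΘcU w hw, hΘr, hΘr, show u (ofComplex w) = F w from rfl]
      ring
    · rw [extendZero_of_not_im_pos Ψ₂ hw, hPdef]
      have hwΘ : w ∉ tsupport Θ := fun h => hw (hΘU h)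
      have hΘ0 : Θ =ᶠ[𝓝 w] 0 := notMem_tsupport_iff_eventuallyEq.mp hwΘ
      simp only [hΘ0.fderiv_eq]
      simp
  have hΨ₁ext : ∀ w, extendZero Ψ₁ w = Q 1 w + Q Complex.I w := by
    intro w
    by_cases hw : 0 < w.im
    · rw [extendZero_of_im_pos Ψ₁ hw, hΨ₁def, hQdef]
      simp only [gradNormSq]
      rw [hFU w hw, hFU w hw, hΘU' w hw]
      push_cast
      rw [e1, e1]
      ring
    · rw [extendZero_of_not_im_pos Ψ₁ hw, hQdef]
      have hΘ0 : Θ w = 0 := image_eq_zero_of_notMem_tsupport fun h => hw (hΘU h)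
      simp only [hΘ0]
      ring
  have hRext : ∀ w, P 1 w + P Complex.I w + (Q 1 w + Q Complex.I w) =
      fderiv ℝ F w 1 * fderiv ℝ G w 1 + fderiv ℝ F w Complex.I * fderiv ℝ G w Complex.I := by
    intro w
    by_cases hw : 0 < w.im
    · rw [hGderiv w hw, hGderiv w hw, hPdef, hQdef]
      ring
    · have hwG : w ∉ tsupport G := fun h => hw (hGU h)
      have hG0 : G =ᶠ[𝓝 w] 0 := notMem_tsupport_iff_eventuallyEq.mp hwG
      have hwΘ : w ∉ tsupport Θ := fun h => hw (hΘU h)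
      have hΘ0 : Θ =ᶠ[𝓝 w] 0 := notMem_tsupport_iff_eventuallyEq.mp hwΘ
      have hGfd0 : fderiv ℝ G w = 0 := by rw [hG0.fderiv_eq]; simp
      have hΘfd0 : fderiv ℝ Θ w = 0 := by rw [hΘ0.fderiv_eq]; simp
      have hΘw0 : Θ w = 0 := image_eq_zero_of_notMem_tsupport hwΘ
      simp only [hPdef, hQdef, hGfd0, hΘfd0, hΘw0, FunLike.coe_zero, Pi.zero_apply,
        mul_zero, zero_add]
  -- integrability of the pieces `P e`, `Q e`
  have hΘc : Continuous Θ := (contDiff_of_contDiffOn_of_tsupport_subset hUo hΘ1 hΘU).continuous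
  have hΘdc : ∀ e, Continuous fun w => fderiv ℝ Θ w e := fun e =>
    ((contDiff_of_contDiffOn_of_tsupport_subset hUo hΘ1 hΘU).continuous_fderiv one_ne_zero).clm_apply
      continuous_const
  have hFc : ContinuousOn F U := hF1.continuousOn
  have hFdc : ∀ e, ContinuousOn (fun w => fderiv ℝ F w e) U := fun e =>
    (hF1.continuousOn_fderiv_of_isOpen hUo le_rfl).clm_apply continuousOn_const
  have hPint : ∀ e, Integrable (P e) := by
    intro e
    have h1 : Continuous fun w => conj (F w) * fderiv ℝ Θ w e :=
      continuous_mul_of_tsupport_subset hUo (Complex.continuous_conj.comp_continuousOn hFc) (hΘdc e)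
        ((tsupport_fderiv_apply_subset ℝ e).trans hΘU)
    have h1s : HasCompactSupport fun w => conj (F w) * fderiv ℝ Θ w e := (hΘs.fderiv_apply (𝕜 := ℝ) e).mul_left
    have h1U : tsupport (fun w => conj (F w) * fderiv ℝ Θ w e) ⊆ U :=
      (tsupport_mul_subset_right (f := fun w => conj (F w)) (g := fun w => fderiv ℝ Θ w e)).trans
        ((tsupport_fderiv_apply_subset ℝ e).trans hΘU)
    exact (continuous_mul_of_tsupport_subset hUo (hFdc e) h1 h1U).integrable_of_hasCompactSupport h1s.mul_left
  have hQint : ∀ e, Integrable (Q e) := by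
    intro e
    have h1 : Continuous fun w => conj (fderiv ℝ F w e) * Θ w :=
      continuous_mul_of_tsupport_subset hUo (Complex.continuous_conj.comp_continuousOn (hFdc e)) hΘc hΘU
    have h1s : HasCompactSupport fun w => conj (fderiv ℝ F w e) * Θ w := hΘs.mul_left
    have h1U : tsupport (fun w => conj (fderiv ℝ F w e) * Θ w) ⊆ U :=
      (tsupport_mul_subset_right (f := fun w => conj (fderiv ℝ F w e)) (g := Θ)).trans hΘU
    exact (continuous_mul_of_tsupport_subset hUo (hFdc e) h1 h1U).integrable_of_hasCompactSupport h1s.mul_left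
  -- assemble
  rw [hL, hR1, integral_im_sq_mul_eq_integral_extendZero, integral_im_sq_mul_eq_integral_extendZero,
    integral_im_sq_mul_eq_integral_extendZero]
  have eL : ∫ w, extendZero Ψ w = -(∫ w, fderiv ℝ (fun w => fderiv ℝ F w 1) w 1 * G w) -
      ∫ w, fderiv ℝ (fun w => fderiv ℝ F w Complex.I) w Complex.I * G w := by
    have h1 : ∫ w, extendZero Ψ w = ∫ w, (-(fderiv ℝ (fun w => fderiv ℝ F w 1) w 1 * G w) -
        fderiv ℝ (fun w => fderiv ℝ F w Complex.I) w Complex.I * G w) :=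
      integral_congr_ae (Eventually.of_forall hLext)
    have h2 : ∫ w, (-(fderiv ℝ (fun w => fderiv ℝ F w 1) w 1 * G w) -
        fderiv ℝ (fun w => fderiv ℝ F w Complex.I) w Complex.I * G w) =
        (∫ w, -(fderiv ℝ (fun w => fderiv ℝ F w 1) w 1 * G w)) -
          ∫ w, fderiv ℝ (fun w => fderiv ℝ F w Complex.I) w Complex.I * G w :=
      integral_sub hA1.neg hA2
    rw [h1, h2, integral_neg]
  have eR1 : ∫ w, extendZero Ψ₁ w = (∫ w, Q 1 w) + ∫ w, Q Complex.I w := by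
    rw [← integral_add (hQint 1) (hQint Complex.I)]
    exact integral_congr_ae (Eventually.of_forall fun w => hΨ₁ext w)
  have eR2 : ∫ w, extendZero Ψ₂ w = (∫ w, P 1 w) + ∫ w, P Complex.I w := by
    rw [← integral_add (hPint 1) (hPint Complex.I)]
    exact integral_congr_ae (Eventually.of_forall fun w => hΨ₂ext w)
  have hP2 : ∫ w, (P 1 w + P Complex.I w) = (∫ w, P 1 w) + ∫ w, P Complex.I w :=
    integral_add (hPint 1) (hPint Complex.I)
  have hQ2 : ∫ w, (Q 1 w + Q Complex.I w) = (∫ w, Q 1 w) + ∫ w, Q Complex.I w :=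
    integral_add (hQint 1) (hQint Complex.I)
  have hBB : ∫ w, (fderiv ℝ F w 1 * fderiv ℝ G w 1 + fderiv ℝ F w Complex.I * fderiv ℝ G w Complex.I) =
      (∫ w, fderiv ℝ F w 1 * fderiv ℝ G w 1) + ∫ w, fderiv ℝ F w Complex.I * fderiv ℝ G w Complex.I :=
    integral_add hB1 hB2
  have hPQ : ∫ w, ((P 1 w + P Complex.I w) + (Q 1 w + Q Complex.I w)) =
      (∫ w, (P 1 w + P Complex.I w)) + ∫ w, (Q 1 w + Q Complex.I w) :=
    integral_add ((hPint 1).add (hPint Complex.I)) ((hQint 1).add (hQint Complex.I))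
  have hcongr : ∫ w, (fderiv ℝ F w 1 * fderiv ℝ G w 1 + fderiv ℝ F w Complex.I * fderiv ℝ G w Complex.I) =
      ∫ w, ((P 1 w + P Complex.I w) + (Q 1 w + Q Complex.I w)) :=
    integral_congr_ae (Eventually.of_forall fun w => (hRext w).symm)
  rw [eL, eR1, eR2, I1, I2]
  rw [hcongr, hPQ, hP2, hQ2] at hBB
  linear_combination (-1 : ℂ) * hBB

end Green

/-! ## 4. A smooth partition of unity on `ℝ` by integer translates; periodisation of integrals -/

section Periodisation

/-- The bump `χ(x) = ST(x + 1) - ST(x)` (`ST` = `Real.smoothTransition`): smooth, supported in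
`[-1, 1]`, with `Σ_{n ∈ ℤ} χ(x + n) = 1` (the sum telescopes). [folklore] -/
def unitBump (x : ℝ) : ℝ := Real.smoothTransition (x + 1) - Real.smoothTransition x

/-- `χ` is smooth. [folklore] -/
theorem contDiff_unitBump {n : ℕ∞} : ContDiff ℝ n unitBump :=
  (Real.smoothTransition.contDiff.comp (contDiff_id.add contDiff_const)).sub Real.smoothTransition.contDiff

/-- `χ` is continuous. [folklore] -/
theorem continuous_unitBump : Continuous unitBump := (contDiff_unitBump (n := 0)).continuous

/-- `χ(x) = 0` for `x ≤ -1`. [folklore] -/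
theorem unitBump_of_le_neg_one {x : ℝ} (hx : x ≤ -1) : unitBump x = 0 := by
  unfold unitBump
  rw [Real.smoothTransition.zero_of_nonpos (by linarith), Real.smoothTransition.zero_of_nonpos (by linarith), sub_zero]

/-- `χ(x) = 0` for `x ≥ 1`. [folklore] -/
theorem unitBump_of_one_le {x : ℝ} (hx : 1 ≤ x) : unitBump x = 0 := by
  unfold unitBump
  rw [Real.smoothTransition.one_of_one_le (by linarith), Real.smoothTransition.one_of_one_le hx, sub_self]

/-- `χ` vanishes off `[-1, 1]`. [folklore] -/
theorem unitBump_eq_zero_of_not_mem {x : ℝ} (hx : x ∉ Icc (-1 : ℝ) 1) : unitBump x = 0 := by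
  rw [mem_Icc, not_and_or, not_le, not_le] at hx
  rcases hx with h | h
  · exact unitBump_of_le_neg_one h.le
  · exact unitBump_of_one_le h.le

/-- `χ` has compact support. [folklore] -/
theorem hasCompactSupport_unitBump : HasCompactSupport unitBump :=
  HasCompactSupport.intro isCompact_Icc fun _ hx => unitBump_eq_zero_of_not_mem hx

/-- **Partition of unity on a period**: `χ(x - 1) + χ(x) = 1` for `x ∈ [0, 1]` (only the translates
by `0` and `-1` meet `[0, 1]`). [folklore] -/
theorem unitBump_sub_one_add {x : ℝ} (hx : x ∈ Icc (0 : ℝ) 1) : unitBump (x - 1) + unitBump x = 1 := by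
  unfold unitBump
  rw [sub_add_cancel, Real.smoothTransition.one_of_one_le (show 1 ≤ x + 1 by linarith [hx.1]),
    Real.smoothTransition.zero_of_nonpos (show x - 1 ≤ 0 by linarith [hx.2])]
  ring

/-- The derivative of `ST` vanishes off `(0, 1)`. [folklore] -/
theorem deriv_smoothTransition_eq_zero {x : ℝ} (hx : x ≤ 0 ∨ 1 ≤ x) : deriv Real.smoothTransition x = 0 := by
  rcases hx with h | h
  · -- `ST = 0` on `(-∞, 0]`, and `ST` is differentiable: derivative of the constant on the left
    have hd := (Real.smoothTransition.contDiff (n := 1)).differentiable one_ne_zero x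
    have hmin : IsLocalMin Real.smoothTransition x := by
      filter_upwards [] with y
      rw [Real.smoothTransition.zero_of_nonpos h]
      exact Real.smoothTransition.nonneg y
    exact hmin.deriv_eq_zero
  · have hmax : IsLocalMax Real.smoothTransition x := by
      filter_upwards [] with y
      rw [Real.smoothTransition.one_of_one_le h]
      exact Real.smoothTransition.le_one y
    exact hmax.deriv_eq_zero

/-- The derivatives of the two translates cancel on `[0, 1]`: `χ'(x - 1) + χ'(x) = 0`. [folklore] -/
theorem deriv_unitBump_sub_one_add {x : ℝ} (hx : x ∈ Icc (0 : ℝ) 1) :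
    deriv unitBump (x - 1) + deriv unitBump x = 0 := by
  have hST : Differentiable ℝ Real.smoothTransition :=
    (Real.smoothTransition.contDiff (n := 1)).differentiable one_ne_zero
  have hd : ∀ y, deriv unitBump y = deriv Real.smoothTransition (y + 1) - deriv Real.smoothTransition y := by
    intro y
    have h1 : DifferentiableAt ℝ (fun x => Real.smoothTransition (x + 1)) y :=
      (hST (y + 1)).comp y ((differentiableAt_id).add (differentiableAt_const 1))
    have e : unitBump = fun x => Real.smoothTransition (x + 1) - Real.smoothTransition x := rfl
    rw [e, deriv_fun_sub h1 (hST y), deriv_comp_add_const]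
  rw [hd, hd, sub_add_cancel, deriv_smoothTransition_eq_zero (Or.inr (show 1 ≤ x + 1 by linarith [hx.1])),
    deriv_smoothTransition_eq_zero (Or.inl (show x - 1 ≤ 0 by linarith [hx.2]))]
  ring

/-- `χ'` is continuous. [folklore] -/
theorem continuous_deriv_unitBump : Continuous (deriv unitBump) :=
  (contDiff_unitBump (n := 1)).continuous_deriv le_rfl

/-- An integral over `ℝ` of a continuous function vanishing off `[-1, 1]` is its interval integral. [folklore] -/
theorem integral_eq_intervalIntegral_of_support {f : ℝ → ℂ} (hf : ∀ x, x ∉ Icc (-1 : ℝ) 1 → f x = 0) :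
    ∫ x, f x = ∫ x in (-1 : ℝ)..1, f x := by
  rw [intervalIntegral.integral_of_le (by norm_num), ← integral_Icc_eq_integral_Ioc,
    setIntegral_eq_integral_of_forall_compl_eq_zero hf]

/-- **Periodisation**: for continuous `1`-periodic `p`, `∫_ℝ p χ = ∫_0^1 p`. [folklore] -/
theorem integral_mul_unitBump {p : ℝ → ℂ} (hp : Continuous p) (hper : ∀ x, p (x + 1) = p x) :
    ∫ x, p x * (unitBump x : ℂ) = ∫ x in (0 : ℝ)..1, p x := by
  have hf : ∀ x, x ∉ Icc (-1 : ℝ) 1 → p x * (unitBump x : ℂ) = 0 := fun x hx => by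
    rw [unitBump_eq_zero_of_not_mem hx]; simp
  have hc : Continuous fun x => p x * (unitBump x : ℂ) := hp.mul (Complex.continuous_ofReal.comp continuous_unitBump)
  rw [integral_eq_intervalIntegral_of_support hf,
    ← intervalIntegral.integral_add_adjacent_intervals (b := 0) (hc.intervalIntegrable _ _) (hc.intervalIntegrable _ _)]
  have h1 : ∫ x in (-1 : ℝ)..0, p x * (unitBump x : ℂ) = ∫ x in (0 : ℝ)..1, p x * (unitBump (x - 1) : ℂ) := by
    have h := intervalIntegral.integral_comp_sub_right (fun x => p x * (unitBump x : ℂ)) (1 : ℝ) (a := 0) (b := 1)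
    norm_num at h
    rw [← h]
    refine intervalIntegral.integral_congr fun x _ => ?_
    have := hper (x - 1)
    rw [sub_add_cancel] at this
    simp only [this]
  have hc1 : Continuous fun x => p x * (unitBump (x - 1) : ℂ) :=
    hp.mul (Complex.continuous_ofReal.comp (continuous_unitBump.comp (continuous_id.sub continuous_const)))
  rw [h1, ← intervalIntegral.integral_add (hc1.intervalIntegrable _ _) (hc.intervalIntegrable _ _)]
  refine intervalIntegral.integral_congr fun x hx => ?_
  rw [uIcc_of_le zero_le_one] at hx
  rw [← mul_add, ← Complex.ofReal_add, unitBump_sub_one_add hx]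
  simp

/-- … and `∫_ℝ p χ' = 0` (the translates of `χ'` cancel on a period). [folklore] -/
theorem integral_mul_deriv_unitBump {p : ℝ → ℂ} (hp : Continuous p) (hper : ∀ x, p (x + 1) = p x) :
    ∫ x, p x * ((deriv unitBump x : ℝ) : ℂ) = 0 := by
  have hf : ∀ x, x ∉ Icc (-1 : ℝ) 1 → p x * ((deriv unitBump x : ℝ) : ℂ) = 0 := by
    intro x hx
    have hx' : unitBump =ᶠ[𝓝 x] fun _ => 0 := by
      have ho : IsOpen (Icc (-1 : ℝ) 1)ᶜ := isClosed_Icc.isOpen_compl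
      filter_upwards [ho.mem_nhds hx] with y hy
      exact unitBump_eq_zero_of_not_mem hy
    rw [hx'.deriv_eq, deriv_const]; simp
  have hc : Continuous fun x => p x * ((deriv unitBump x : ℝ) : ℂ) :=
    hp.mul (Complex.continuous_ofReal.comp continuous_deriv_unitBump)
  rw [integral_eq_intervalIntegral_of_support hf,
    ← intervalIntegral.integral_add_adjacent_intervals (b := 0) (hc.intervalIntegrable _ _) (hc.intervalIntegrable _ _)]
  have h1 : ∫ x in (-1 : ℝ)..0, p x * ((deriv unitBump x : ℝ) : ℂ) =
      ∫ x in (0 : ℝ)..1, p x * ((deriv unitBump (x - 1) : ℝ) : ℂ) := by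
    have h := intervalIntegral.integral_comp_sub_right (fun x => p x * ((deriv unitBump x : ℝ) : ℂ)) (1 : ℝ)
      (a := 0) (b := 1)
    norm_num at h
    rw [← h]
    refine intervalIntegral.integral_congr fun x _ => ?_
    have := hper (x - 1)
    rw [sub_add_cancel] at this
    simp only [this]
  have hc1 : Continuous fun x => p x * ((deriv unitBump (x - 1) : ℝ) : ℂ) :=
    hp.mul (Complex.continuous_ofReal.comp (continuous_deriv_unitBump.comp (continuous_id.sub continuous_const)))
  rw [h1, ← intervalIntegral.integral_add (hc1.intervalIntegrable _ _) (hc.intervalIntegrable _ _)]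
  rw [show (0 : ℂ) = ∫ x in (0 : ℝ)..1, (0 : ℂ) by simp]
  refine intervalIntegral.integral_congr fun x hx => ?_
  rw [uIcc_of_le zero_le_one] at hx
  rw [← mul_add, ← Complex.ofReal_add, deriv_unitBump_sub_one_add hx]
  simp

end Periodisation

/-! ## 5. Green's identity on the strip `[0,1] × (0,∞)` for `1`-periodic functions -/

section Strip

/-- The point `x + iy ∈ ℍ` for `y > 0` (through `ofComplex`, so that no proof is needed inside
integrals over `y ∈ (0, ∞)`). [folklore] -/
def pt (x y : ℝ) : ℍ := ofComplex ⟨x, y⟩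

/-- For `y > 0` the point is `⟨x + iy, _⟩`. [folklore] -/
theorem pt_eq {x y : ℝ} (hy : 0 < y) : pt x y = ⟨⟨x, y⟩, hy⟩ := ofComplex_apply_of_im_pos hy

/-- Its imaginary part. [folklore] -/
theorem pt_im {x y : ℝ} (hy : 0 < y) : (pt x y).im = y := by rw [pt_eq hy]; rfl

/-- Its real part. [folklore] -/
theorem pt_re {x y : ℝ} (hy : 0 < y) : (pt x y).re = x := by rw [pt_eq hy]; rfl

/-- Its underlying complex number. [folklore] -/
theorem coe_pt {x y : ℝ} (hy : 0 < y) : ((pt x y : ℍ) : ℂ) = ⟨x, y⟩ := by rw [pt_eq hy]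

/-- `x ↦ x + iy` is continuous into `ℍ`. [folklore] -/
theorem continuous_pt {y : ℝ} (hy : 0 < y) : Continuous fun x : ℝ => pt x y := by
  have e : (fun x : ℝ => pt x y) = fun x : ℝ => (⟨⟨x, y⟩, hy⟩ : ℍ) := funext fun x => pt_eq hy
  rw [e]
  refine UpperHalfPlane.isEmbedding_coe.continuous_iff.mpr ?_
  exact continuous_iff_continuousAt.mpr fun x => (hasDerivAt_mk_fst x y).continuousAt

/-- Translating the point: `pt (x + 1) y = 1 +ᵥ pt x y`. [folklore] -/
theorem pt_add_one {x y : ℝ} (hy : 0 < y) : pt (x + 1) y = (1 : ℝ) +ᵥ pt x y := by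
  rw [pt_eq hy, pt_eq hy]
  apply UpperHalfPlane.ext
  rw [coe_vadd]
  apply Complex.ext <;> simp [add_comm]

variable {u : ℍ → ℂ}

/-- The derivative of a `1`-periodic function is `1`-periodic. [folklore] -/
theorem hypFDeriv_vadd_one (hper : ∀ z : ℍ, u ((1 : ℝ) +ᵥ z) = u z) (z : ℍ) :
    hypFDeriv u ((1 : ℝ) +ᵥ z) = hypFDeriv u z := by
  unfold hypFDeriv
  have hfun : (u ∘ ofComplex : ℂ → ℂ) = fun w => (u ∘ ofComplex) (w + 1) := by
    funext w
    simp only [Function.comp_apply]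
    by_cases hw : 0 < w.im
    · have hw1 : 0 < (w + 1).im := by simpa using hw
      rw [ofComplex_apply_of_im_pos hw1, ofComplex_apply_of_im_pos hw]
      have : (⟨w + 1, hw1⟩ : ℍ) = (1 : ℝ) +ᵥ (⟨w, hw⟩ : ℍ) := by
        apply UpperHalfPlane.ext; rw [coe_vadd]; push_cast; ring
      rw [this, hper]
    · have hw1 : ¬ 0 < (w + 1).im := by simpa using hw
      rw [ofComplex_apply_of_im_nonpos (not_lt.mp hw), ofComplex_apply_of_im_nonpos (not_lt.mp hw1)]
  conv_rhs => rw [hfun, fderiv_comp_add_right]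
  congr 1
  rw [coe_vadd]; push_cast; ring

/-- `|∇u|²` of a `1`-periodic function is `1`-periodic. [folklore] -/
theorem gradNormSq_vadd_one (hper : ∀ z : ℍ, u ((1 : ℝ) +ᵥ z) = u z) (z : ℍ) :
    gradNormSq u ((1 : ℝ) +ᵥ z) = gradNormSq u z := by
  unfold gradNormSq; rw [hypFDeriv_vadd_one hper]

/-- The partial derivatives of a `C²` function on `ℍ` are continuous. [folklore] -/
theorem continuous_hypFDeriv_apply (hu : IsC2 u) (e : ℂ) : Continuous fun z : ℍ => hypFDeriv u z e := by
  have h1 : ContinuousOn (fun w : ℂ => fderiv ℝ (u ∘ ofComplex) w e) {w : ℂ | 0 < w.im} :=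
    ((hu.continuousOn_fderiv_of_isOpen isOpen_upperHalfPlaneSet (by norm_num)).clm_apply continuousOn_const)
  exact h1.comp_continuous UpperHalfPlane.continuous_coe fun z => z.im_pos

/-- The rectangle `{z ∈ ℍ : Re z ∈ [a, b], Im z ∈ [c, d]}` with `c > 0` is compact. [folklore] -/
theorem isCompact_box {a b c d : ℝ} (hc : 0 < c) :
    IsCompact {z : ℍ | z.re ∈ Icc a b ∧ z.im ∈ Icc c d} := by
  have hclosed : IsClosed {z : ℍ | z.re ∈ Icc a b ∧ z.im ∈ Icc c d} :=
    (isClosed_Icc.preimage UpperHalfPlane.continuous_re).inter (isClosed_Icc.preimage UpperHalfPlane.continuous_im)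
  refine Metric.isCompact_of_isClosed_isBounded hclosed ?_
  rw [Metric.isBounded_iff_subset_closedBall UpperHalfPlane.I]
  refine ⟨(|a| + |b| + |d| + 1) / Real.sqrt c, fun z hz => ?_⟩
  obtain ⟨⟨ha, hb⟩, hcz, hd⟩ := hz
  rw [Metric.mem_closedBall]
  have h1 := dist_le_dist_coe_div_sqrt z UpperHalfPlane.I
  rw [UpperHalfPlane.I_im, mul_one] at h1
  refine h1.trans ?_
  have hsqrt : Real.sqrt c ≤ Real.sqrt z.im := Real.sqrt_le_sqrt hcz
  have hnum : dist (z : ℂ) (UpperHalfPlane.I : ℂ) ≤ |a| + |b| + |d| + 1 := by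
    rw [Complex.dist_eq]
    have e : (z : ℂ) - (UpperHalfPlane.I : ℂ) = ⟨z.re, z.im - 1⟩ := by apply Complex.ext <;> simp
    rw [e]
    calc ‖(⟨z.re, z.im - 1⟩ : ℂ)‖ ≤ |z.re| + |z.im - 1| := Complex.norm_le_abs_re_add_abs_im _
      _ ≤ (|a| + |b|) + (|d| + 1) := by
          refine add_le_add (abs_le.mpr ⟨?_, ?_⟩) (abs_le.mpr ⟨?_, ?_⟩)
          · linarith [neg_abs_le a, abs_nonneg b]
          · linarith [le_abs_self b, abs_nonneg a]
          · linarith [z.im_pos, abs_nonneg d]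
          · linarith [le_abs_self d]
      _ = |a| + |b| + |d| + 1 := by ring
  calc dist (z : ℂ) (UpperHalfPlane.I : ℂ) / Real.sqrt z.im ≤ (|a| + |b| + |d| + 1) / Real.sqrt z.im :=
        div_le_div_of_nonneg_right hnum (Real.sqrt_nonneg _)
    _ ≤ (|a| + |b| + |d| + 1) / Real.sqrt c :=
        div_le_div_of_nonneg_left (by positivity) (Real.sqrt_pos.mpr hc) hsqrt

variable {η : ℝ → ℝ}

/-- The separated weight `θ(z) = η(Im z) χ(Re z)`. [folklore] -/
def stripWeight (η : ℝ → ℝ) (z : ℍ) : ℝ := η z.im * unitBump z.re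

/-- Its complex extension through `ofComplex` agrees on `{Im > 0}` with the explicit smooth function
`w ↦ η(Im w) χ(Re w)`. [folklore] -/
theorem stripWeight_ofComplex_eq {w : ℂ} (hw : 0 < w.im) :
    ((stripWeight η (ofComplex w) : ℝ) : ℂ) = ((η w.im * unitBump w.re : ℝ) : ℂ) := by
  unfold stripWeight
  rw [ofComplex_apply_of_im_pos hw]; rfl

/-- The explicit extension is `C¹` for `η ∈ C¹`. [folklore] -/
theorem contDiff_stripWeight_ext (hη : ContDiff ℝ 1 η) :
    ContDiff ℝ 1 fun w : ℂ => ((η w.im * unitBump w.re : ℝ) : ℂ) := by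
  have h1 : ContDiff ℝ 1 fun w : ℂ => η w.im * unitBump w.re :=
    (hη.comp Complex.imCLM.contDiff).mul ((contDiff_unitBump (n := 1)).comp Complex.reCLM.contDiff)
  exact Complex.ofRealCLM.contDiff.comp h1

/-- Its partial derivatives: `∂ₓ = η(y) χ'(x)`, `∂_y = η'(y) χ(x)`. [folklore] -/
theorem fderiv_stripWeight_ext (hη : ContDiff ℝ 1 η) (w : ℂ) :
    fderiv ℝ (fun w : ℂ => ((η w.im * unitBump w.re : ℝ) : ℂ)) w 1 = ((η w.im * deriv unitBump w.re : ℝ) : ℂ) ∧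
    fderiv ℝ (fun w : ℂ => ((η w.im * unitBump w.re : ℝ) : ℂ)) w Complex.I =
      ((deriv η w.im * unitBump w.re : ℝ) : ℂ) := by
  have hηd : HasDerivAt η (deriv η w.im) w.im := ((hη.differentiable one_ne_zero) w.im).hasDerivAt
  have hχd : HasDerivAt unitBump (deriv unitBump w.re) w.re :=
    (((contDiff_unitBump (n := 1)).differentiable one_ne_zero) w.re).hasDerivAt
  have hA : HasFDerivAt (fun w : ℂ => η w.im) ((deriv η w.im) • Complex.imCLM) w :=
    (hηd.comp_hasFDerivAt w Complex.imCLM.hasFDerivAt).congr_of_eventuallyEq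
      (Eventually.of_forall fun _ => rfl)
  have hB : HasFDerivAt (fun w : ℂ => unitBump w.re) ((deriv unitBump w.re) • Complex.reCLM) w :=
    (hχd.comp_hasFDerivAt w Complex.reCLM.hasFDerivAt).congr_of_eventuallyEq
      (Eventually.of_forall fun _ => rfl)
  have hAB : HasFDerivAt (fun w : ℂ => η w.im * unitBump w.re)
      (η w.im • ((deriv unitBump w.re) • Complex.reCLM) + unitBump w.re • ((deriv η w.im) • Complex.imCLM)) w :=
    hA.mul hB
  have hC := Complex.ofRealCLM.hasFDerivAt.comp w hAB
  have e : (fun w : ℂ => ((η w.im * unitBump w.re : ℝ) : ℂ)) = Complex.ofRealCLM ∘ fun w : ℂ => η w.im * unitBump w.re := rfl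
  rw [e, hC.fderiv]
  constructor
  · simp
  · simp; ring

/-- The strip weight is a compactly supported function on `ℍ` when `η` has compact support in
`(0, ∞)`. [folklore] -/
theorem hasCompactSupport_stripWeight (hηs : HasCompactSupport η) (hη0 : tsupport η ⊆ Ioi 0) :
    HasCompactSupport (stripWeight η) := by
  obtain ⟨R, hR⟩ := hηs.isCompact.isBounded.subset_closedBall 0
  -- `tsupport η ⊆ [c, d]` with `c > 0`
  have hcpt : IsCompact (tsupport η) := hηs
  by_cases hne : (tsupport η).Nonempty
  · obtain ⟨c, hc, hcmin⟩ := hcpt.exists_isMinOn hne continuous_id.continuousOn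
    obtain ⟨d, hd, hdmax⟩ := hcpt.exists_isMaxOn hne continuous_id.continuousOn
    have hc0 : 0 < c := hη0 hc
    refine HasCompactSupport.intro (isCompact_box (a := -1) (b := 1) (c := c) (d := d) hc0) fun z hz => ?_
    unfold stripWeight
    simp only [mem_setOf_eq, not_and_or] at hz
    rcases hz with hz | hz
    · rw [unitBump_eq_zero_of_not_mem hz, mul_zero]
    · have : z.im ∉ tsupport η := by
        intro hmem
        exact hz ⟨hcmin hmem, hdmax hmem⟩
      rw [image_eq_zero_of_notMem_tsupport this, zero_mul]
  · rw [not_nonempty_iff_eq_empty] at hne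
    have hη : η = 0 := by
      funext y
      exact image_eq_zero_of_notMem_tsupport (by rw [hne]; exact notMem_empty y)
    have : stripWeight η = 0 := by funext z; simp [stripWeight, hη]
    rw [this]
    exact HasCompactSupport.zero

/-- **Fubini on `ℍ` with periodisation**: for a continuous `1`-periodic `P : ℍ → ℂ` and a continuous
compactly supported `w` on `(0, ∞)`,
`∫_ℍ P(z) w(Im z) χ(Re z) dμ(z) = ∫_0^∞ w(y) y⁻² (∫_0^1 P(x + iy) dx) dy`. [folklore] -/
theorem integral_mul_stripWeight {P : ℍ → ℂ} (hP : Continuous P) (hper : ∀ z : ℍ, P ((1 : ℝ) +ᵥ z) = P z)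
    {w : ℝ → ℝ} (hw : Continuous w) (hws : HasCompactSupport w) (hw0 : tsupport w ⊆ Ioi 0) :
    ∫ z : ℍ, P z * (stripWeight w z : ℂ) =
      ∫ y in Ioi (0 : ℝ), ((w y * (y ^ 2)⁻¹ : ℝ) : ℂ) * ∫ x in (0 : ℝ)..1, P (pt x y) := by
  set Φ : ℍ → ℂ := fun z => P z * (stripWeight w z : ℂ) with hΦdef
  have hΦc : Continuous Φ := by
    refine hP.mul (Complex.continuous_ofReal.comp ?_)
    exact (hw.comp UpperHalfPlane.continuous_im).mul (continuous_unitBump.comp UpperHalfPlane.continuous_re)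
  have hΦi : Integrable Φ := hΦc.integrable_of_hasCompactSupport
    ((hasCompactSupport_stripWeight hws hw0).comp_left Complex.ofReal_zero).mul_left
  set g : ℂ → ℂ := fun z => ((z.im ^ 2)⁻¹ : ℝ) • Φ (ofComplex z) with hgdef
  have hgi : IntegrableOn g {z : ℂ | 0 < z.im} := (integrable_upperHalfPlane_iff_integrableOn_complex Φ).mp hΦi
  rw [integral_upperHalfPlane_eq_integral_complex, setIntegral_upperHalf_eq_iterated g hgi]
  refine setIntegral_congr_fun measurableSet_Ioi fun y hy => ?_
  have hy' : 0 < y := hy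
  -- the fibre at height `y`
  have hfib : ∀ x : ℝ, g ⟨x, y⟩ = ((w y * (y ^ 2)⁻¹ : ℝ) : ℂ) * (P (pt x y) * (unitBump x : ℂ)) := by
    intro x
    simp only [hgdef, hΦdef, stripWeight]
    rw [show (ofComplex (⟨x, y⟩ : ℂ) : ℍ) = pt x y from rfl, pt_im hy', pt_re hy', Complex.real_smul]
    push_cast
    ring
  simp_rw [hfib]
  rw [integral_const_mul, integral_mul_unitBump (p := fun x => P (pt x y)) (hP.comp (continuous_pt hy')) fun x => ?_]
  rw [pt_add_one hy', hper]

/-- The weight `w(Im z) χ'(Re z)` has compact support too. [folklore] -/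
theorem hasCompactSupport_stripWeight_deriv {w : ℝ → ℝ} (hws : HasCompactSupport w) (hw0 : tsupport w ⊆ Ioi 0) :
    HasCompactSupport fun z : ℍ => w z.im * deriv unitBump z.re := by
  by_cases hne : (tsupport w).Nonempty
  · obtain ⟨c, hc, hcmin⟩ := hws.isCompact.exists_isMinOn hne continuous_id.continuousOn
    obtain ⟨d, hd, hdmax⟩ := hws.isCompact.exists_isMaxOn hne continuous_id.continuousOn
    have hc0 : 0 < c := hw0 hc
    refine HasCompactSupport.intro (isCompact_box (a := -1) (b := 1) (c := c) (d := d) hc0) fun z hz => ?_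
    simp only [mem_setOf_eq, not_and_or] at hz
    rcases hz with hz | hz
    · have hx' : unitBump =ᶠ[𝓝 z.re] fun _ => 0 := by
        have ho : IsOpen (Icc (-1 : ℝ) 1)ᶜ := isClosed_Icc.isOpen_compl
        filter_upwards [ho.mem_nhds hz] with t ht
        exact unitBump_eq_zero_of_not_mem ht
      rw [hx'.deriv_eq, deriv_const, mul_zero]
    · have : z.im ∉ tsupport w := fun hmem => hz ⟨hcmin hmem, hdmax hmem⟩
      rw [image_eq_zero_of_notMem_tsupport this, zero_mul]
  · rw [not_nonempty_iff_eq_empty] at hne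
    have hw' : w = 0 := by
      funext y
      exact image_eq_zero_of_notMem_tsupport (by rw [hne]; exact notMem_empty y)
    have : (fun z : ℍ => w z.im * deriv unitBump z.re) = 0 := by funext z; simp [hw']
    rw [this]; exact HasCompactSupport.zero

/-- Integrability of `P · w(Im) χ(Re)` for continuous `P`. [folklore] -/
theorem integrable_mul_stripWeight {P : ℍ → ℂ} (hP : Continuous P) {w : ℝ → ℝ} (hw : Continuous w)
    (hws : HasCompactSupport w) (hw0 : tsupport w ⊆ Ioi 0) :
    Integrable fun z : ℍ => P z * (stripWeight w z : ℂ) := by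
  refine (hP.mul (Complex.continuous_ofReal.comp ?_)).integrable_of_hasCompactSupport
    ((hasCompactSupport_stripWeight hws hw0).comp_left Complex.ofReal_zero).mul_left
  exact (hw.comp UpperHalfPlane.continuous_im).mul (continuous_unitBump.comp UpperHalfPlane.continuous_re)

/-- Integrability of `P · w(Im) χ'(Re)` for continuous `P`. [folklore] -/
theorem integrable_mul_stripWeight_deriv {P : ℍ → ℂ} (hP : Continuous P) {w : ℝ → ℝ} (hw : Continuous w)
    (hws : HasCompactSupport w) (hw0 : tsupport w ⊆ Ioi 0) :
    Integrable fun z : ℍ => P z * ((w z.im * deriv unitBump z.re : ℝ) : ℂ) := by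
  refine (hP.mul (Complex.continuous_ofReal.comp ?_)).integrable_of_hasCompactSupport
    ((hasCompactSupport_stripWeight_deriv hws hw0).comp_left Complex.ofReal_zero).mul_left
  exact (hw.comp UpperHalfPlane.continuous_im).mul (continuous_deriv_unitBump.comp UpperHalfPlane.continuous_re)

/-- … and with `χ'` in place of `χ` the integral vanishes. [folklore] -/
theorem integral_mul_stripWeight_deriv {P : ℍ → ℂ} (hP : Continuous P) (hper : ∀ z : ℍ, P ((1 : ℝ) +ᵥ z) = P z)
    {w : ℝ → ℝ} (hw : Continuous w) (hws : HasCompactSupport w) (hw0 : tsupport w ⊆ Ioi 0) :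
    ∫ z : ℍ, P z * ((w z.im * deriv unitBump z.re : ℝ) : ℂ) = 0 := by
  set Φ : ℍ → ℂ := fun z => P z * ((w z.im * deriv unitBump z.re : ℝ) : ℂ) with hΦdef
  have hΦi : Integrable Φ := integrable_mul_stripWeight_deriv hP hw hws hw0
  set g : ℂ → ℂ := fun z => ((z.im ^ 2)⁻¹ : ℝ) • Φ (ofComplex z) with hgdef
  have hgi : IntegrableOn g {z : ℂ | 0 < z.im} := (integrable_upperHalfPlane_iff_integrableOn_complex Φ).mp hΦi
  rw [integral_upperHalfPlane_eq_integral_complex, setIntegral_upperHalf_eq_iterated g hgi]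
  rw [show (0 : ℂ) = ∫ y in Ioi (0 : ℝ), (0 : ℂ) by simp]
  refine setIntegral_congr_fun measurableSet_Ioi fun y hy => ?_
  have hy' : 0 < y := hy
  have hfib : ∀ x : ℝ, g ⟨x, y⟩ = ((w y * (y ^ 2)⁻¹ : ℝ) : ℂ) * (P (pt x y) * ((deriv unitBump x : ℝ) : ℂ)) := by
    intro x
    simp only [hgdef, hΦdef]
    rw [show (ofComplex (⟨x, y⟩ : ℂ) : ℍ) = pt x y from rfl, pt_im hy', pt_re hy', Complex.real_smul]
    push_cast
    ring
  simp_rw [hfib]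
  rw [integral_const_mul, integral_mul_deriv_unitBump (p := fun x => P (pt x y)) (hP.comp (continuous_pt hy'))
    fun x => ?_, mul_zero]
  rw [pt_add_one hy', hper]

variable (u)

/-- The hyperbolic Laplacian of a `1`-periodic `C²` function is `1`-periodic (invariance of `Δ`
under the translation `n(1) ∈ SL₂(ℝ)`). [cite: Iwaniec2002, §1.6, PDF p. 16] -/
theorem hypLaplacian_vadd_one (hu : IsC2 u) (hper : ∀ z : ℍ, u ((1 : ℝ) +ᵥ z) = u z) (z : ℍ) :
    hypLaplacian u ((1 : ℝ) +ᵥ z) = hypLaplacian u z := by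
  set g : GL (Fin 2) ℝ := Matrix.SpecialLinearGroup.toGL (translSL 1) with hgdef
  have hg : 0 < g.det.val := by simp [hgdef]
  have hgz : ∀ w : ℍ, g • w = (1 : ℝ) +ᵥ w := fun w => toGL_translSL_smul 1 w
  have hfun : (fun w => u (g • w)) = u := funext fun w => by rw [hgz, hper]
  have hC2 : ContDiffAt ℝ 2 (u ∘ ofComplex : ℂ → ℂ) ((g • z : ℍ) : ℂ) :=
    hu.contDiffAt (isOpen_upperHalfPlaneSet.mem_nhds (g • z).im_pos)
  have h := hypLaplacian_comp_smul hg u z hC2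
  rw [hfun, hgz] at h
  exact h.symm

variable {u}

/-- **Green's identity on the strip for `1`-periodic functions**: for `u ∈ C²(ℍ)` with
`u(z + 1) = u(z)` and a `C¹` weight `η` compactly supported in `(0, ∞)`,
`∫_0^∞ η(y) y⁻² ∫_0^1 (-Δu) ū dx dy = ∫_0^∞ η(y) ∫_0^1 |∇u|² dx dy + ∫_0^∞ η'(y) ∫_0^1 ū u_y dx dy`
(Green's formula on `[0,1] × supp η`; the vertical sides cancel by periodicity). This is the
identity behind Roelcke's argument (proof of Theorem 11.4: the energy integral over
`{0 ≤ x ≤ B, y > √3/2}`). [cite: Iwaniec2002, Lemma 4.1 & proof of Thm 11.4, PDF pp. 48, 121–122] -/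
theorem strip_green (hu : IsC2 u) (hper : ∀ z : ℍ, u ((1 : ℝ) +ᵥ z) = u z) {η : ℝ → ℝ}
    (hη : ContDiff ℝ 1 η) (hηs : HasCompactSupport η) (hη0 : tsupport η ⊆ Ioi 0) :
    ∫ y in Ioi (0 : ℝ), ((η y * (y ^ 2)⁻¹ : ℝ) : ℂ) * ∫ x in (0 : ℝ)..1, -hypLaplacian u (pt x y) * conj (u (pt x y)) =
      (∫ y in Ioi (0 : ℝ), ((η y : ℝ) : ℂ) * ∫ x in (0 : ℝ)..1, (gradNormSq u (pt x y) : ℂ)) +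
        ∫ y in Ioi (0 : ℝ), ((deriv η y : ℝ) : ℂ) *
          ∫ x in (0 : ℝ)..1, conj (u (pt x y)) * hypFDeriv u (pt x y) Complex.I := by
  set θ : ℍ → ℝ := stripWeight η with hθdef
  have hθs : HasCompactSupport θ := hasCompactSupport_stripWeight hηs hη0
  have hθ : ContDiffOn ℝ 1 (fun z : ℂ => ((θ (ofComplex z) : ℝ) : ℂ)) {z : ℂ | 0 < z.im} :=
    (contDiff_stripWeight_ext hη).contDiffOn.congr fun w hw => stripWeight_ofComplex_eq hw
  have hG := green_weight hu hθ hθs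
  have hηc : Continuous η := hη.continuous
  have hη'c : Continuous (deriv η) := hη.continuous_deriv le_rfl
  have hη's : HasCompactSupport (deriv η) := hηs.deriv
  have hη'0 : tsupport (deriv η) ⊆ Ioi 0 := tsupport_deriv_subset.trans hη0
  have huc : Continuous u := hu.continuous
  -- the three `1`-periodic continuous integrands
  set P₁ : ℍ → ℂ := fun z => -hypLaplacian u z * conj (u z) with hP₁
  set P₂ : ℍ → ℂ := fun z => ((z.im ^ 2 * gradNormSq u z : ℝ) : ℂ) with hP₂
  set P₄ : ℍ → ℂ := fun z => ((z.im : ℝ) : ℂ) ^ 2 * (conj (u z) * hypFDeriv u z Complex.I) with hP₄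
  set P₃ : ℍ → ℂ := fun z => ((z.im : ℝ) : ℂ) ^ 2 * (conj (u z) * hypFDeriv u z 1) with hP₃
  have hP₁c : Continuous P₁ := ((continuous_hypLaplacian hu).neg).mul (Complex.continuous_conj.comp huc)
  have hP₂c : Continuous P₂ := Complex.continuous_ofReal.comp
    ((UpperHalfPlane.continuous_im.pow 2).mul ((continuous_hypFDeriv_apply hu 1).norm.pow 2 |>.add
      ((continuous_hypFDeriv_apply hu Complex.I).norm.pow 2)))
  have hP₃c : Continuous P₃ := ((Complex.continuous_ofReal.comp UpperHalfPlane.continuous_im).pow 2).mul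
    ((Complex.continuous_conj.comp huc).mul (continuous_hypFDeriv_apply hu 1))
  have hP₄c : Continuous P₄ := ((Complex.continuous_ofReal.comp UpperHalfPlane.continuous_im).pow 2).mul
    ((Complex.continuous_conj.comp huc).mul (continuous_hypFDeriv_apply hu Complex.I))
  have hP₁p : ∀ z, P₁ ((1 : ℝ) +ᵥ z) = P₁ z := fun z => by
    simp only [hP₁, hypLaplacian_vadd_one u hu hper, hper]
  have hP₂p : ∀ z, P₂ ((1 : ℝ) +ᵥ z) = P₂ z := fun z => by
    simp only [hP₂, vadd_im, gradNormSq_vadd_one hper]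
  have hP₃p : ∀ z, P₃ ((1 : ℝ) +ᵥ z) = P₃ z := fun z => by
    simp only [hP₃, vadd_im, hper, hypFDeriv_vadd_one hper]
  have hP₄p : ∀ z, P₄ ((1 : ℝ) +ᵥ z) = P₄ z := fun z => by
    simp only [hP₄, vadd_im, hper, hypFDeriv_vadd_one hper]
  -- LHS
  have hL : ∫ z : ℍ, -hypLaplacian u z * conj (u z) * θ z = ∫ z : ℍ, P₁ z * (stripWeight η z : ℂ) := by rfl
  rw [hL, integral_mul_stripWeight hP₁c hP₁p hηc hηs hη0] at hG
  -- first term of the RHS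
  have hR1 : ∫ z : ℍ, ((z.im ^ 2 * gradNormSq u z * θ z : ℝ) : ℂ) = ∫ z : ℍ, P₂ z * (stripWeight η z : ℂ) := by
    congr 1 with z; simp only [hP₂, hθdef]; push_cast; ring
  rw [hR1, integral_mul_stripWeight hP₂c hP₂p hηc hηs hη0] at hG
  -- second term of the RHS: the gradient of the weight
  have hgrad : ∀ z : ℍ, gradPair u (fun w => (θ w : ℂ)) z =
      hypFDeriv u z 1 * ((η z.im * deriv unitBump z.re : ℝ) : ℂ) +
        hypFDeriv u z Complex.I * ((deriv η z.im * unitBump z.re : ℝ) : ℂ) := by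
    intro z
    have heq : ((fun w => (θ w : ℂ)) ∘ ofComplex : ℂ → ℂ) =ᶠ[𝓝 (z : ℂ)]
        fun w : ℂ => ((η w.im * unitBump w.re : ℝ) : ℂ) := by
      filter_upwards [isOpen_upperHalfPlaneSet.mem_nhds z.im_pos] with w hw
      exact stripWeight_ofComplex_eq hw
    have hd := fderiv_stripWeight_ext hη (z : ℂ)
    unfold gradPair
    rw [show hypFDeriv (fun w => (θ w : ℂ)) z = fderiv ℝ (fun w : ℂ => ((η w.im * unitBump w.re : ℝ) : ℂ)) z from
      heq.fderiv_eq, hd.1, hd.2, Complex.conj_ofReal, Complex.conj_ofReal]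
    rfl
  have hR2 : ∫ z : ℍ, ((z.im : ℝ) : ℂ) ^ 2 * (conj (u z) * gradPair u (fun w => (θ w : ℂ)) z) =
      (∫ z : ℍ, P₃ z * ((η z.im * deriv unitBump z.re : ℝ) : ℂ)) + ∫ z : ℍ, P₄ z * (stripWeight (deriv η) z : ℂ) := by
    rw [← integral_add (integrable_mul_stripWeight_deriv hP₃c hηc hηs hη0)
      (integrable_mul_stripWeight hP₄c hη'c hη's hη'0)]
    congr 1 with z
    rw [hgrad z]
    simp only [hP₃, hP₄, stripWeight]
    push_cast
    ring
  rw [hR2, integral_mul_stripWeight_deriv hP₃c hP₃p hηc hηs hη0, zero_add,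
    integral_mul_stripWeight hP₄c hP₄p hη'c hη's hη'0] at hG
  -- simplify the fibre integrals
  rw [hG]
  congr 1
  · refine setIntegral_congr_fun measurableSet_Ioi fun y hy => ?_
    have hy' : (0 : ℝ) < y := hy
    have e2 : ∫ x in (0 : ℝ)..1, P₂ (pt x y) = ((y ^ 2 : ℝ) : ℂ) * ∫ x in (0 : ℝ)..1, (gradNormSq u (pt x y) : ℂ) := by
      rw [← intervalIntegral.integral_const_mul]
      refine intervalIntegral.integral_congr fun x _ => ?_
      simp only [hP₂, pt_im hy']; push_cast; ring
    rw [e2, ← mul_assoc]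
    congr 1
    have : (y : ℂ) ≠ 0 := by exact_mod_cast hy'.ne'
    push_cast
    field_simp
  · refine setIntegral_congr_fun measurableSet_Ioi fun y hy => ?_
    have hy' : (0 : ℝ) < y := hy
    have e4 : ∫ x in (0 : ℝ)..1, P₄ (pt x y) =
        ((y ^ 2 : ℝ) : ℂ) * ∫ x in (0 : ℝ)..1, conj (u (pt x y)) * hypFDeriv u (pt x y) Complex.I := by
      rw [← intervalIntegral.integral_const_mul]
      refine intervalIntegral.integral_congr fun x _ => ?_
      simp only [hP₄, pt_im hy']; push_cast; ring
    rw [e4, ← mul_assoc]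
    congr 1
    have : (y : ℂ) ≠ 0 := by exact_mod_cast hy'.ne'
    push_cast
    field_simp

end Strip

end Literature.NumberTheory.Automorphic
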